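import Literature.ModelTheory.ExponentialFields.PilaWilkieCounting
import Literature.ModelTheory.ExponentialFields.WilkieConjectureProofs
import Literature.ModelTheory.ExponentialFields.InterpolationStep
import Literature.ModelTheory.ExponentialFields.TarskiSeidenbergProofs
import Literature.ModelTheory.ExponentialFields.OMinimalDefinability
import Literature.ModelTheory.ExponentialFields.OMinimalMonotonicity
import Literature.ModelTheory.ExponentialFields.OMinimalIntervals
import Mathlib.Analysis.Calculus.Monotone
import Mathlib.Analysis.Calculus.ContDiff.Deriv
import Mathlib.Analysis.Calculus.ContDiff.Bounds
import Mathlib.Analysis.Calculus.IteratedDeriv.Lemmas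
import Mathlib.Analysis.Calculus.Deriv.MeanValue
import Mathlib.Analysis.Calculus.Deriv.Pow
import Literature.ModelTheory.ExponentialFields.OMinimalCellDecomposition
import HarnessLib

/-!
# The Pila–Wilkie counting theorem (Pila–Wilkie 2006, Thm. 1.8) — proof file, first steps

Sibling proof file of `PilaWilkieCounting.lean` (the named fact `PilaWilkie2006_thm_1_8`:
for `X ⊆ ℝⁿ` definable in an o-minimal expansion of the real field and `ε > 0`,
`N(X − X^alg, T) ≤ c(X, ε) T^ε`).

Source (read in full, 2026-08-15): J. Pila, A. J. Wilkie, *The rational points of a definable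
set*, Duke Math. J. 133 (2006), 591–616 [PilaWilkie2006], author version (MIMS eprint
2007.198), §§1, 6, 7.

## Architecture of the printed proof and status in the tree

1. §§2–5, **the `r`-parametrization theorem** (Thm. 2.3, Cor. 5.1) and its uniform version for
   definable families (Cor. 5.2): every definable `X ⊆ (0,1)ⁿ` of dimension `k` is covered by
   the images of finitely many definable `C^{(r)}` maps `(0,1)^k → X` with all derivatives up
   to order `r` bounded by `1`, the number of maps uniform over a definable family. **Not in
   the tree** (it needs `C^{(r)}` cell decomposition in o-minimal expansions of fields, van den
   Dries 1998 Ch. 7, and the saturation/definable-Skolem-function argument of §4); this is the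
   missing core.
2. §6, Prop. 6.1 (= Pila 2004, 4.2; the Bombieri–Pila determinant method): the rational points
   of height `≤ T` on the image of one such chart `φ : (0,1)^k → ℝⁿ`, `k < n`, lie on
   `≤ C(k, n, d) T^{ε(k, n, d)}` hypersurfaces of degree `≤ d`, with `ε(k, n, d) → 0` as
   `d → ∞`. **Proved here** (`PilaWilkie2006_prop_6_1`) from the one-ball step
   `exists_mvPolynomial_of_image_ball` / `exists_mvPolynomial_of_image_unitCube`
   (`BombieriPilaDeterminant.lean`, `InterpolationStep.lean`) by covering `(0,1)^k` with
   `T₀^k` balls of radius `1/(2T₀)`, `T₀ ≍ H^{dnμ/B}`, and the elementary parameter choice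
   `b + 1 = A d`, `A = ⌈2kn/ε⌉`, `d = 2 · n! · (k + A)^k` giving `2 D_k(b) ≤ μ = binom(n+d, d)`,
   hence `k d n μ / B ≤ ε` (ours; the source takes `r(k,n,d) = b(k,n,d) + 1` of Pila 2004 and
   observes `ε(k,n,d) → 0`). Prop. 6.2 (the "Main Lemma") is 6.1 composed with Cor. 5.2 —
   blocked on item 1.
3. §7, proof of Thm. 1.10 (⇒ 1.9 ⇒ 1.8) by induction on the fibre dimension. **Proved here**:
   the first reductions of 7.1 — additivity of the bound under `A ∪ B = C`
   (`transPart_union_subset`, `exists_bound_union`), the zero-dimensional / finite case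
   (`exists_bound_of_transPart_finite`), interior points lie in `X^alg` (the case `k = n`:
   *"If `x ∈ reg_k(X)` of any fibre `X`, then `X` contains an open ball in `ℝⁿ` containing `x`.
   Therefore `x ∈ X^alg`"*, `interior_subset_algPart`), and the cases `n ≤ 1` of Thm. 1.8
   (`PilaWilkie2006_thm_1_8_zero`, `PilaWilkie2006_thm_1_8_one`: in `ℝ¹` the transcendental
   part of a definable set is finite by o-minimality alone); and **the reduction to subsets of
   the open unit cube** `(0,1)ⁿ` *"since the rational points of height `≤ T` are stable under
   the maps `x ↦ ±x^{±1}`, as are the algebraic parts of a set … by a suitable induction on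
   `n`"*: transport of `X^alg`, `X^trans`, `X(ℚ, H)` under bi-semialgebraic homeomorphisms
   (`algPart_image_eq`, `transPart_image_eq`, `ratPointsLE_image_eq`), the coordinate maps
   `x_i ↦ -x_i`, `x_i ↦ 1/x_i` and the slices `x_i = c` (semialgebraic images via
   `IsSemialgebraic.preimage_aeval` and Tarski–Seidenberg `tarski_seidenberg_real_holds`;
   heights via `mulHeight₁_neg/inv`; definability from the graphs of `+`, `·` —
   `definable_lt_of_field`, `definableFun_neg/inv`), and the induction
   `exists_bound_of_forall_unitCube`, packaged as `PilaWilkie2006_thm_1_8_of_unitCube`: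
   Theorem 1.8 follows from its case `X ⊆ (0,1)ⁿ`. Not yet here: the definability of `reg_k`
   in families (van den Dries–Miller 1996), the family `Σ` of hypersurface choices and the sets
   `A₁, A₂, A₃, B` of the induction on fibre dimension.
4. Towards item 1 (the analytic input of the parametrization theorem: van den Dries 1998,
   Ch. 7, (2.5) *"If `f : I → R` is definable, then `f` is differentiable at all but finitely
   many points of `I`"* and its iterate in the proof of the `C^1` cell decomposition (3.2)):
   **definable unary functions over `ℝ` are `C^k` off a finite set**
   (`finite_setOf_not_differentiableAt`, `exists_finset_contDiffOn`), for definable *families*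
   `Φ v` (closure under definable substitutions, the hypothesis `hΦ`), with the derivative
   relation and `deriv` definable (`definable_setOf_hasDerivAt`, `definableFamily_deriv`).
   Over `ℝ` the printed Dini-derivative argument is replaced by Lebesgue's theorem
   (`MonotoneOn.ae_differentiableWithinAt_of_mem`) on a monotonicity interval (as in
   A. J. Wilkie, *Rational points on definable sets*, Ex. 4.4(2)); the complement of the
   `C^k` locus is definable uniformly in parameters and **uniformly finite** over definable
   families (`exists_ncard_not_locallyContDiff_le`, van den Dries 1998, Ch. 3, (2.13)).
5. Item 1, §3 (the analytic lemmas of the unary reparametrization, over `ℝ` with explicit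
   constants): **Pila–Wilkie 2006, Lemma 3.1** (`PilaWilkie2006_lemma_3_1`: if `f` is `C^r` on
   `(0,1)`, `|f^{(j)}| ≤ c` for `j < r` and `|f^{(r)}|` is antitone then `g = f(x²)` has
   `|g^{(i)}| ≤ 2^r r! · 5c` for `i ≤ r`), through `sq_trick_aux` (an induction on `r` via
   `(f ∘ sq)' = 2x · (f' ∘ sq)` and the Leibniz bound, replacing the printed Faà di Bruno
   bookkeeping) and the mean value step `abs_iteratedDerivWithin_le_div_of_antitoneOn`
   (`|f^{(r)}(y)| ≤ 4c/y`); and affine reparametrizations `x ↦ p + qx`, `|q| ≤ 1`, do not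
   increase derivative bounds (`iteratedDerivWithin_comp_affine`,
   `abs_iteratedDerivWithin_comp_affine_le`; proof of Lemmas 3.2/3.3).

Nothing in this file is a named fact; no definitions.

## References

* J. Pila, A. J. Wilkie, *The rational points of a definable set*, Duke Math. J. 133 (2006),
  591–616: §6 (Prop. 6.1, 6.2), §7 (7.1). [PilaWilkie2006]
* J. Pila, *Integer points on the dilation of a subanalytic surface*, Q. J. Math. 55 (2004),
  207–223, 4.2 (the source of 6.1). [Pila2004]
* J. Pila, *Point-Counting and the Zilber–Pink Conjecture*, CUP 2022, Lemma 9.7, Prop. 9.8.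
  [Pila2022]
* L. van den Dries, *Tame topology and o-minimal structures*, CUP 1998, Ch. 3, (1.2), (2.13);
  Ch. 7, (1.1), (2.5), (3.2). [Dries1998]
* A. J. Wilkie, *Rational points on definable sets*, in: G. O. Jones, A. J. Wilkie (eds.),
  *O-Minimality and Diophantine Geometry*, LMS Lecture Note Series 421, CUP 2015, §§4–5
  (Ex. 4.4(2), Lemma 5.1, Thm. 5.7, Rem. 5.8). [Wilkie2015]
-/

noncomputable section

open Set FirstOrder FirstOrder.Language

namespace Literature.ModelTheory.ExponentialFields

/-! ### §6, Prop. 6.1: rational points on one chart with bounded derivatives -/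

section PropSixOne

/-- The one-ball step on each ball of the grid, collected as a finite set of hypersurfaces (the
form used by Pila–Wilkie: *"`X(ℚ, T)` is contained in the union of at most `C(k,n,d) T^{ε(k,n,d)}`
hypersurfaces of degree `≤ d`"*): under the smallness condition of
`exists_mvPolynomial_of_image_ball` at radius `1/(2T)`, the rational points of height `≤ H` on
`φ(I^m)` lie on at most `T^m` hypersurfaces of degree `≤ d` (same proof as
`exists_mvPolynomial_of_image_unitCube`, without multiplying the polynomials out).
[cite: PilaWilkie2006, Prop. 6.1 (proof)] [cite: Pila2022, Prop. 9.8 (proof)] -/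
theorem exists_finset_mvPolynomial_of_image_unitCube {m n d b H T : ℕ}
    (φ : (Fin m → ℝ) → Fin n → ℝ)
    (hφ : ∀ l, ContDiffOn ℝ (b + 1) (fun x => φ x l) (Set.pi Set.univ fun _ : Fin m => Set.Ioo (0 : ℝ) 1))
    (hφb : ∀ l, ∀ i ≤ b + 1, ∀ x ∈ Set.pi Set.univ (fun _ : Fin m => Set.Ioo (0 : ℝ) 1),
      ‖iteratedFDeriv ℝ i (fun x => φ x l) x‖ ≤ 1)
    (hd : 1 ≤ d) (hT : 1 ≤ T)
    (hD : ∑ β ∈ Finset.range (b + 1), (m + β - 1).choose β ≤ (n + d).choose d)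
    (hsmall : (H : ℝ) ^ (d * n * (n + d).choose d) *
      (((n + d).choose d).factorial * ((b + 2) ^ (n + d).choose d *
        (((d : ℝ) ^ (b + 1)) ^ (n + d).choose d *
          (1 / (2 * T) : ℝ) ^ (∑ β ∈ Finset.range (b + 1), (m + β - 1).choose β * β +
            (b + 1) * ((n + d).choose d - ∑ β ∈ Finset.range (b + 1), (m + β - 1).choose β))))) < 1) :
    ∃ 𝓟 : Finset (MvPolynomial (Fin n) ℝ), 𝓟.card ≤ T ^ m ∧
      (∀ P ∈ 𝓟, P ≠ 0 ∧ P.totalDegree ≤ d) ∧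
      ratPointsLE (φ '' Set.pi Set.univ (fun _ : Fin m => Set.Ioo (0 : ℝ) 1)) H ⊆
        ⋃ P ∈ 𝓟, {x | MvPolynomial.eval x P = 0} := by
  classical
  set U : Set (Fin m → ℝ) := Set.pi Set.univ fun _ : Fin m => Set.Ioo (0 : ℝ) 1 with hU
  have hUo : IsOpen U := isOpen_set_pi Set.finite_univ fun _ _ => isOpen_Ioo
  have hUc : Convex ℝ U := convex_pi fun _ _ => convex_Ioo 0 1
  have hT' : (0 : ℝ) < T := by exact_mod_cast hT
  have hρ0 : (0 : ℝ) ≤ 1 / (2 * T) := by positivity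
  have hρ1 : (1 / (2 * T) : ℝ) ≤ 1 := by
    rw [div_le_one (by positivity)]
    have : (1 : ℝ) ≤ T := by exact_mod_cast hT
    linarith
  have hball : ∀ j : Fin m → Fin T, ∃ P : MvPolynomial (Fin n) ℝ, P ≠ 0 ∧ P.totalDegree ≤ d ∧
      ∀ x ∈ ratPointsLE (Set.univ : Set (Fin n → ℝ)) H,
        (∃ z ∈ U, ‖z - fun i => (((j i : ℕ) : ℝ) + 1 / 2) / T‖ ≤ 1 / (2 * T) ∧ φ z = x) →
          MvPolynomial.eval x P = 0 := fun j =>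
    exists_mvPolynomial_of_image_ball hUo hUc φ hφ hφb (gridCentre_mem_unitCube hT j) hρ0 hρ1 hd
      hD hsmall
  choose P hP0 hPd hPz using hball
  refine ⟨Finset.univ.image P, ?_, ?_, ?_⟩
  · calc (Finset.univ.image P).card ≤ (Finset.univ : Finset (Fin m → Fin T)).card :=
          Finset.card_image_le
      _ = T ^ m := by simp
  · intro Q hQ
    obtain ⟨j, -, rfl⟩ := Finset.mem_image.mp hQ
    exact ⟨hP0 j, hPd j⟩
  · intro x hx
    rw [mem_ratPointsLE_iff] at hx
    obtain ⟨⟨z, hzU, hzx⟩, hxq⟩ := hx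
    obtain ⟨j, hj⟩ := exists_norm_sub_gridCentre_le hT hzU
    have hxu : x ∈ ratPointsLE (Set.univ : Set (Fin n → ℝ)) H :=
      mem_ratPointsLE_iff.mpr ⟨Set.mem_univ x, hxq⟩
    have hj0 : MvPolynomial.eval x (P j) = 0 := hPz j x hxu ⟨z, hzU, hj, hzx⟩
    exact Set.mem_iUnion₂.mpr ⟨P j, Finset.mem_image_of_mem P (Finset.mem_univ j), hj0⟩

/-- The parameter choice for Prop. 6.1 (ours): given `1 ≤ k < n` and `A ≥ 1`, with
`d = 2 · n! · (k + A)^k` and `b + 1 = A d` one has `2 D_k(b) ≤ μ = binom(n + d, d)`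
(`D_k(b) ≤ (k + b)^k ≤ (k + A)^k d^k` and `2 n! (k + A)^k d^k = d^{k+1} ≤ (d+1)^n ≤ μ n!`).
[folklore] -/
theorem two_mul_partialDim_le_choose_of_params {k n A : ℕ} (hk : 1 ≤ k) (hkn : k < n) (hA : 1 ≤ A) :
    2 * ∑ β ∈ Finset.range (A * (2 * n.factorial * (k + A) ^ k) - 1 + 1), (k + β - 1).choose β ≤
      (n + 2 * n.factorial * (k + A) ^ k).choose (2 * n.factorial * (k + A) ^ k) := by
  set d : ℕ := 2 * n.factorial * (k + A) ^ k with hd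
  have hd1 : 1 ≤ d := by
    have := Nat.factorial_pos n
    have : 1 ≤ (k + A) ^ k := Nat.one_le_pow _ _ (by omega)
    rw [hd]; nlinarith
  have hb : A * d - 1 + 1 = A * d := Nat.sub_add_cancel (Nat.one_le_iff_ne_zero.mpr (by positivity))
  rw [hb]
  have hD : ∑ β ∈ Finset.range (A * d), (k + β - 1).choose β ≤ (k + A) ^ k * d ^ k := by
    have h1 := partialDim_le_pow hk (A * d - 1)
    rw [hb] at h1
    refine h1.trans ?_
    rw [← mul_pow]
    apply Nat.pow_le_pow_left
    have : k ≤ k * d := Nat.le_mul_of_pos_right k hd1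
    calc k + (A * d - 1) ≤ k * d + A * d := by omega
      _ = (k + A) * d := by ring
  have key : 2 * ((k + A) ^ k * d ^ k) * n.factorial ≤ (n + d).choose d * n.factorial := by
    calc 2 * ((k + A) ^ k * d ^ k) * n.factorial = d * d ^ k := by rw [hd]; ring
      _ = d ^ (k + 1) := by ring
      _ ≤ d ^ n := Nat.pow_le_pow_right hd1 hkn
      _ ≤ (d + 1) ^ n := Nat.pow_le_pow_left (Nat.le_succ d) n
      _ ≤ (n + d).choose d * n.factorial := succ_pow_le_choose_mul_factorial n d
  have h2 := Nat.le_of_mul_le_mul_right key (Nat.factorial_pos n)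
  exact le_trans (Nat.mul_le_mul_left 2 hD) h2

/-- The radius/cover choice (ours): for `X ≥ 1` and `B ≥ 1`, `T = ⌈X^{1/B}⌉` satisfies `T ≥ 1`,
`X (1/(2T))^B < 1` and `T ≤ 2 X^{1/B}`. [folklore] -/
theorem natCeil_rpow_inv_spec {X : ℝ} {B : ℕ} (hX : 1 ≤ X) (hB : 1 ≤ B) :
    1 ≤ ⌈X ^ (1 / (B : ℝ))⌉₊ ∧ X * (1 / (2 * (⌈X ^ (1 / (B : ℝ))⌉₊ : ℕ)) : ℝ) ^ B < 1 ∧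
      ((⌈X ^ (1 / (B : ℝ))⌉₊ : ℕ) : ℝ) ≤ 2 * X ^ (1 / (B : ℝ)) := by
  set Y : ℝ := X ^ (1 / (B : ℝ)) with hY
  have hX0 : 0 < X := by linarith
  have hY1 : 1 ≤ Y := Real.one_le_rpow hX (by positivity)
  have hY0 : 0 < Y := by linarith
  have hYB : Y ^ B = X := by
    rw [hY, ← Real.rpow_natCast, ← Real.rpow_mul hX0.le, one_div_mul_cancel (by positivity),
      Real.rpow_one]
  have hT1 : 1 ≤ ⌈Y⌉₊ := Nat.one_le_iff_ne_zero.mpr (Nat.pos_iff_ne_zero.mp (Nat.ceil_pos.mpr hY0))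
  have hTY : Y ≤ (⌈Y⌉₊ : ℕ) := Nat.le_ceil Y
  have hT0 : (0 : ℝ) < (⌈Y⌉₊ : ℕ) := by exact_mod_cast hT1
  refine ⟨hT1, ?_, ?_⟩
  · -- `X (1/(2T))^B = X / (2^B T^B) ≤ X/(2^B X) = 2^{-B} < 1`
    have hTB : X ≤ ((⌈Y⌉₊ : ℕ) : ℝ) ^ B := hYB ▸ pow_le_pow_left₀ hY0.le hTY B
    have h2B : (2 : ℝ) ≤ (2 : ℝ) ^ B := by
      calc (2 : ℝ) = 2 ^ 1 := (pow_one _).symm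
        _ ≤ 2 ^ B := pow_le_pow_right₀ (by norm_num) hB
    rw [div_pow, one_pow, mul_pow, mul_one_div]
    rw [div_lt_one (by positivity)]
    calc X ≤ ((⌈Y⌉₊ : ℕ) : ℝ) ^ B := hTB
      _ = 1 * ((⌈Y⌉₊ : ℕ) : ℝ) ^ B := (one_mul _).symm
      _ < 2 ^ B * ((⌈Y⌉₊ : ℕ) : ℝ) ^ B := by gcongr; linarith
  · calc ((⌈Y⌉₊ : ℕ) : ℝ) ≤ Y + 1 := (Nat.ceil_lt_add_one hY0.le).le
      _ ≤ 2 * Y := by linarith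


/-- **Pila–Wilkie 2006, Proposition 6.1** (after Pila 2004, 4.2; Bombieri–Pila 1989). Printed:
*"Let `k, n ∈ ℕ` with `k < n`. Then there is for each `d ∈ ℕ, d ≥ 1` a nonnegative integer
`r = r(k, n, d)` and positive constants `ε(k, n, d)`, `C(k, n, d)` with the following property.
Suppose `φ : (0,1)^k → ℝⁿ` is a function of class `C^{(r)}` with `|φ^{(α)}(x)| ≤ 1` for all
`x ∈ (0,1)^k` and all `α ∈ ℕ^k` with `|α| ≤ r`. Let `X = φ((0,1)^k)` and `T ≥ 1`. Then `X(ℚ, T)`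
is contained in the union of at most `C(k,n,d) T^{ε(k,n,d)}` hypersurfaces of degree `≤ d`.
Further, `ε(k,n,d) → 0` as `d → ∞`."* Recorded in the form in which it is consumed (6.2, 7.1):
for all `k < n` and `ε > 0` there are a smoothness order `r = b + 1`, a degree `d ≥ 1` and
`C > 0` such that for every chart `φ : (0,1)^k → ℝⁿ` whose coordinates are `C^{b+1}` with
`‖D^i φ_l‖ ≤ 1` on `(0,1)^k` for `i ≤ b + 1` (operator norms of the Fréchet derivatives, which
dominate the partials) and every integer `H ≥ 1`, the set `(φ((0,1)^k))(ℚ, H)` lies on the union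
of a finite set of at most `C H^ε` hypersurfaces `{P = 0}`, `P ≠ 0`, `deg P ≤ d`. Proof: the
one-ball step on the `T₀^k` balls of radius `1/(2T₀)` covering the cube
(`exists_finset_mvPolynomial_of_image_unitCube`) with `T₀ = ⌈(K H^{dnμ})^{1/B}⌉`,
`K = μ! (b+2)^μ d^{(b+1)μ}`, and the parameters of `two_mul_partialDim_le_choose_of_params`,
for which `k d n μ ≤ ε B`. [cite: PilaWilkie2006, Prop. 6.1] [cite: Pila2022, Prop. 9.8] -/
theorem PilaWilkie2006_prop_6_1 {k n : ℕ} (hkn : k < n) {ε : ℝ} (hε : 0 < ε) :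
    ∃ (b d : ℕ) (C : ℝ), 1 ≤ d ∧ 0 < C ∧
      ∀ (φ : (Fin k → ℝ) → Fin n → ℝ),
        (∀ l, ContDiffOn ℝ (b + 1) (fun x => φ x l)
          (Set.pi Set.univ fun _ : Fin k => Set.Ioo (0 : ℝ) 1)) →
        (∀ l, ∀ i ≤ b + 1, ∀ x ∈ Set.pi Set.univ (fun _ : Fin k => Set.Ioo (0 : ℝ) 1),
          ‖iteratedFDeriv ℝ i (fun x => φ x l) x‖ ≤ 1) →
        ∀ H : ℕ, 1 ≤ H →
          ∃ 𝓟 : Finset (MvPolynomial (Fin n) ℝ), (𝓟.card : ℝ) ≤ C * (H : ℝ) ^ ε ∧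
            (∀ P ∈ 𝓟, P ≠ 0 ∧ P.totalDegree ≤ d) ∧
            ratPointsLE (φ '' Set.pi Set.univ (fun _ : Fin k => Set.Ioo (0 : ℝ) 1)) H ⊆
              ⋃ P ∈ 𝓟, {x | MvPolynomial.eval x P = 0} := by
  rcases Nat.eq_zero_or_pos k with rfl | hk
  · -- `k = 0`: the image is one point, on one hyperplane
    have i₀ : Fin n := ⟨0, hkn⟩
    refine ⟨0, 1, 1, le_rfl, one_pos, fun φ _ _ H hH => ?_⟩
    set c : Fin n → ℝ := φ default with hc
    refine ⟨{MvPolynomial.X i₀ - MvPolynomial.C (c i₀)}, ?_, ?_, ?_⟩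
    · rw [Finset.card_singleton, Nat.cast_one, one_mul]
      exact Real.one_le_rpow (by exact_mod_cast hH) hε.le
    · intro P hP
      rw [Finset.mem_singleton] at hP
      subst hP
      refine ⟨fun h => ?_, ?_⟩
      · have h1 := congrArg (MvPolynomial.eval fun _ => c i₀ + 1) h
        simp at h1
      · calc (MvPolynomial.X i₀ - MvPolynomial.C (c i₀) : MvPolynomial (Fin n) ℝ).totalDegree
            ≤ max (MvPolynomial.X i₀ : MvPolynomial (Fin n) ℝ).totalDegree
                (MvPolynomial.C (c i₀) : MvPolynomial (Fin n) ℝ).totalDegree :=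
              MvPolynomial.totalDegree_sub _ _
          _ ≤ 1 := by
              rw [MvPolynomial.totalDegree_X, MvPolynomial.totalDegree_C]
              simp
    · intro x hx
      obtain ⟨⟨z, -, rfl⟩, -⟩ := hx
      have hz : z = default := Subsingleton.elim z default
      subst hz
      simp [hc]
  · -- `k ≥ 1`
    have hk0 : (0 : ℝ) < k := by exact_mod_cast hk
    have hn0 : (0 : ℝ) < n := by exact_mod_cast hk.trans hkn
    obtain ⟨A, hA1, hAε⟩ : ∃ A : ℕ, 1 ≤ A ∧ 2 * k * n / ε ≤ A :=
      ⟨⌈2 * k * n / ε⌉₊,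
        Nat.one_le_iff_ne_zero.mpr (Nat.pos_iff_ne_zero.mp (Nat.ceil_pos.mpr (by positivity))),
        Nat.le_ceil _⟩
    set d : ℕ := 2 * n.factorial * (k + A) ^ k with hd
    have hd1 : 1 ≤ d := by
      have := Nat.factorial_pos n
      have : 1 ≤ (k + A) ^ k := Nat.one_le_pow _ _ (by omega)
      rw [hd]; nlinarith
    have hAd : 1 ≤ A * d := Nat.one_le_iff_ne_zero.mpr (by positivity)
    set b : ℕ := A * d - 1 with hb
    have hb1 : b + 1 = A * d := by rw [hb]; omega
    set μ : ℕ := (n + d).choose d with hμ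
    set D : ℕ := ∑ β ∈ Finset.range (b + 1), (k + β - 1).choose β with hDdef
    set B : ℕ := ∑ β ∈ Finset.range (b + 1), (k + β - 1).choose β * β + (b + 1) * (μ - D)
      with hBdef
    have h2D : 2 * D ≤ μ := two_mul_partialDim_le_choose_of_params hk hkn hA1
    have hDμ : D ≤ μ := by omega
    have hμ1 : 1 ≤ μ := Nat.choose_pos (Nat.le_add_left d n)
    have hAB : A * d * μ ≤ 2 * B := by
      have h3 : μ ≤ 2 * (μ - D) := by omega
      calc A * d * μ = (b + 1) * μ := by rw [hb1]
        _ ≤ (b + 1) * (2 * (μ - D)) := Nat.mul_le_mul_left _ h3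
        _ = 2 * ((b + 1) * (μ - D)) := by ring
        _ ≤ 2 * B := Nat.mul_le_mul_left 2 (Nat.le_add_left _ _)
    have hB1 : 1 ≤ B := by
      have : 1 ≤ A * d * μ := Nat.one_le_iff_ne_zero.mpr (by positivity)
      omega
    -- the exponent: `k d n μ ≤ ε B`
    have hexp : (k * d * n * μ : ℝ) ≤ ε * B := by
      have h1 : (2 * k * n : ℝ) ≤ A * ε := (div_le_iff₀ hε).mp hAε
      have h2 : ((A * d * μ : ℕ) : ℝ) ≤ ((2 * B : ℕ) : ℝ) := by exact_mod_cast hAB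
      push_cast at h2
      have hdμ0 : (0 : ℝ) ≤ d * μ := by positivity
      nlinarith
    -- the constant `K = μ! (b+2)^μ d^{(b+1)μ}` of the smallness condition
    set K : ℝ := (μ.factorial : ℝ) * (((b : ℝ) + 2) ^ μ * ((d : ℝ) ^ (b + 1)) ^ μ) with hK
    have hK1 : 1 ≤ K := by
      refine one_le_mul_of_one_le_of_one_le (by exact_mod_cast Nat.factorial_pos μ)
        (one_le_mul_of_one_le_of_one_le (one_le_pow₀ (by linarith)) (one_le_pow₀ ?_))
      exact one_le_pow₀ (by exact_mod_cast hd1)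
    have hK0 : 0 < K := by linarith
    refine ⟨b, d, (2 * K ^ (1 / (B : ℝ))) ^ k, hd1, by positivity, fun φ hφ hφb H hH => ?_⟩
    have hH1 : (1 : ℝ) ≤ H := by exact_mod_cast hH
    set X : ℝ := K * (H : ℝ) ^ (d * n * μ) with hX
    have hX1 : 1 ≤ X := one_le_mul_of_one_le_of_one_le hK1 (one_le_pow₀ hH1)
    obtain ⟨hT1, hsmall, hTle⟩ := natCeil_rpow_inv_spec hX1 hB1
    set T : ℕ := ⌈X ^ (1 / (B : ℝ))⌉₊ with hT
    have hsmall' : (H : ℝ) ^ (d * n * μ) * ((μ.factorial : ℝ) * (((b : ℝ) + 2) ^ μ *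
        (((d : ℝ) ^ (b + 1)) ^ μ * (1 / (2 * T) : ℝ) ^ B))) < 1 := by
      calc (H : ℝ) ^ (d * n * μ) * ((μ.factorial : ℝ) * (((b : ℝ) + 2) ^ μ *
          (((d : ℝ) ^ (b + 1)) ^ μ * (1 / (2 * T) : ℝ) ^ B))) = X * (1 / (2 * T) : ℝ) ^ B := by
            rw [hX, hK]; ring
        _ < 1 := hsmall
    obtain ⟨𝓟, hcard, hP, hcov⟩ :=
      exists_finset_mvPolynomial_of_image_unitCube φ hφ hφb hd1 hT1 hDμ hsmall'
    refine ⟨𝓟, ?_, hP, hcov⟩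
    have hXsplit : X ^ (1 / (B : ℝ)) =
        K ^ (1 / (B : ℝ)) * (H : ℝ) ^ (((d * n * μ : ℕ) : ℝ) / (B : ℝ)) := by
      rw [hX, Real.mul_rpow hK0.le (by positivity), ← Real.rpow_natCast,
        ← Real.rpow_mul (by positivity), mul_one_div]
    calc (𝓟.card : ℝ) ≤ ((T ^ k : ℕ) : ℝ) := by exact_mod_cast hcard
      _ = (T : ℝ) ^ k := by push_cast; ring
      _ ≤ (2 * X ^ (1 / (B : ℝ))) ^ k := pow_le_pow_left₀ (by positivity) hTle k
      _ = (2 * K ^ (1 / (B : ℝ))) ^ k * ((H : ℝ) ^ (((d * n * μ : ℕ) : ℝ) / (B : ℝ))) ^ k := by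
          rw [hXsplit, ← mul_assoc, mul_pow]
      _ ≤ (2 * K ^ (1 / (B : ℝ))) ^ k * (H : ℝ) ^ ε := by
          gcongr
          rw [← Real.rpow_natCast, ← Real.rpow_mul (by positivity)]
          apply Real.rpow_le_rpow_of_exponent_le hH1
          rw [div_mul_eq_mul_div, div_le_iff₀ (by exact_mod_cast hB1)]
          calc ((d * n * μ : ℕ) : ℝ) * k = k * d * n * μ := by push_cast; ring
            _ ≤ ε * B := hexp

end PropSixOne

/-! ### §7, 7.1: first reductions -/

section Reductions

variable {ι : Type*}

/-- `(A ∪ B)^trans ⊆ A^trans ∪ B^trans`, i.e. `A^alg ∪ B^alg ⊆ (A ∪ B)^alg` (Pila–Wilkie 2006,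
7.1: *"For any `y ∈ Y_C`, it is immediate that `X_{A,y}^alg ∪ X_{B,y}^alg ⊂ X_{C,y}^alg`"*).
[cite: PilaWilkie2006, 7.1] -/
theorem transPart_union_subset (A B : Set (ι → ℝ)) :
    transPart (A ∪ B) ⊆ transPart A ∪ transPart B := by
  intro x hx
  rw [mem_transPart_iff] at hx
  rcases hx.1 with hA | hB
  · exact Or.inl ⟨hA, fun h => hx.2 (algPart_mono subset_union_left h)⟩
  · exact Or.inr ⟨hB, fun h => hx.2 (algPart_mono subset_union_right h)⟩

/-- `(A ∪ B)(ℚ, H) = A(ℚ, H) ∪ B(ℚ, H)`. [folklore] -/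
theorem ratPointsLE_union (A B : Set (ι → ℝ)) (H : ℕ) :
    ratPointsLE (A ∪ B) H = ratPointsLE A H ∪ ratPointsLE B H := by
  ext x
  simp only [mem_ratPointsLE_iff, mem_union]
  tauto

/-- `N((A ∪ B)^trans, H) ≤ N(A^trans, H) + N(B^trans, H)` (Pila–Wilkie 2006, 7.1:
`c(C, ε) = c(A, ε) + c(B, ε)`). [cite: PilaWilkie2006, 7.1] -/
theorem ncard_ratPointsLE_transPart_union_le [Finite ι] (A B : Set (ι → ℝ)) (H : ℕ) :
    (ratPointsLE (transPart (A ∪ B)) H).ncard ≤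
      (ratPointsLE (transPart A) H).ncard + (ratPointsLE (transPart B) H).ncard := by
  calc (ratPointsLE (transPart (A ∪ B)) H).ncard
      ≤ (ratPointsLE (transPart A ∪ transPart B) H).ncard :=
        Set.ncard_le_ncard (ratPointsLE_mono_left (transPart_union_subset A B) H)
          (ratPointsLE_finite _ _)
    _ = (ratPointsLE (transPart A) H ∪ ratPointsLE (transPart B) H).ncard := by
        rw [ratPointsLE_union]
    _ ≤ _ := Set.ncard_union_le _ _

/-- **Additivity of the counting bound** (Pila–Wilkie 2006, 7.1, first reduction: *"if the
theorem holds for `A` and `B` and `ε` … then it holds for `C` with … `c(C, ε) = c(A, ε) +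
c(B, ε)`"*): bounds `c_A H^ε`, `c_B H^ε` for `A`, `B` give the bound `(c_A + c_B) H^ε` for
`A ∪ B`. [cite: PilaWilkie2006, 7.1] -/
theorem exists_bound_union [Finite ι] {A B : Set (ι → ℝ)} {ε : ℝ}
    (hA : ∃ c : ℝ, ∀ H : ℕ, 1 ≤ H → (ratPointsLE (transPart A) H).Finite ∧
      ((ratPointsLE (transPart A) H).ncard : ℝ) ≤ c * (H : ℝ) ^ ε)
    (hB : ∃ c : ℝ, ∀ H : ℕ, 1 ≤ H → (ratPointsLE (transPart B) H).Finite ∧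
      ((ratPointsLE (transPart B) H).ncard : ℝ) ≤ c * (H : ℝ) ^ ε) :
    ∃ c : ℝ, ∀ H : ℕ, 1 ≤ H → (ratPointsLE (transPart (A ∪ B)) H).Finite ∧
      ((ratPointsLE (transPart (A ∪ B)) H).ncard : ℝ) ≤ c * (H : ℝ) ^ ε := by
  obtain ⟨cA, hcA⟩ := hA
  obtain ⟨cB, hcB⟩ := hB
  refine ⟨cA + cB, fun H hH => ⟨ratPointsLE_transPart_finite _ _, ?_⟩⟩
  have h := ncard_ratPointsLE_transPart_union_le A B H
  calc ((ratPointsLE (transPart (A ∪ B)) H).ncard : ℝ)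
      ≤ (ratPointsLE (transPart A) H).ncard + (ratPointsLE (transPart B) H).ncard := by
        exact_mod_cast h
    _ ≤ cA * (H : ℝ) ^ ε + cB * (H : ℝ) ^ ε := add_le_add (hcA H hH).2 (hcB H hH).2
    _ = (cA + cB) * (H : ℝ) ^ ε := by ring

/-- **Finite union version** of the additivity of the bound. [cite: PilaWilkie2006, 7.1] -/
theorem exists_bound_biUnion [Finite ι] {α : Type*} (S : Finset α) (A : α → Set (ι → ℝ))
    {ε : ℝ}
    (hA : ∀ a ∈ S, ∃ c : ℝ, ∀ H : ℕ, 1 ≤ H → (ratPointsLE (transPart (A a)) H).Finite ∧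
      ((ratPointsLE (transPart (A a)) H).ncard : ℝ) ≤ c * (H : ℝ) ^ ε) :
    ∃ c : ℝ, ∀ H : ℕ, 1 ≤ H → (ratPointsLE (transPart (⋃ a ∈ S, A a)) H).Finite ∧
      ((ratPointsLE (transPart (⋃ a ∈ S, A a)) H).ncard : ℝ) ≤ c * (H : ℝ) ^ ε := by
  classical
  induction S using Finset.induction_on with
  | empty =>
    refine ⟨0, fun H _ => ⟨ratPointsLE_transPart_finite _ _, ?_⟩⟩
    have h0 : ratPointsLE (transPart (⋃ a ∈ (∅ : Finset α), A a)) H = ∅ :=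
      Set.eq_empty_of_subset_empty fun x hx => by
        simpa using transPart_subset _ (ratPointsLE_subset _ _ hx)
    rw [h0, Set.ncard_empty, Nat.cast_zero, zero_mul]
  | insert a S ha ih =>
    rw [Finset.set_biUnion_insert]
    exact exists_bound_union (hA a (Finset.mem_insert_self a S))
      (ih fun b hb => hA b (Finset.mem_insert_of_mem hb))

/-- **The zero-dimensional case** (Pila–Wilkie 2006, 7.1: *"If the fibre dimension of `Z` is
zero then there is a uniform bound `c` for the number of points in any fibre, and the theorem
holds with `c(Z, ε) = c`"*), in the form: if `X^trans` is finite then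
`N(X^trans, H) ≤ #X^trans · H^ε`. [cite: PilaWilkie2006, 7.1] -/
theorem exists_bound_of_transPart_finite {X : Set (ι → ℝ)} (hX : (transPart X).Finite) {ε : ℝ}
    (hε : 0 ≤ ε) :
    ∃ c : ℝ, ∀ H : ℕ, 1 ≤ H → (ratPointsLE (transPart X) H).Finite ∧
      ((ratPointsLE (transPart X) H).ncard : ℝ) ≤ c * (H : ℝ) ^ ε := by
  refine ⟨(transPart X).ncard, fun H hH => ⟨hX.subset (ratPointsLE_subset _ _), ?_⟩⟩
  have h1 : ((ratPointsLE (transPart X) H).ncard : ℝ) ≤ (transPart X).ncard := by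
    exact_mod_cast Set.ncard_le_ncard (ratPointsLE_subset _ _) hX
  have h2 : (1 : ℝ) ≤ (H : ℝ) ^ ε := Real.one_le_rpow (by exact_mod_cast hH) hε
  calc ((ratPointsLE (transPart X) H).ncard : ℝ) ≤ (transPart X).ncard := h1
    _ = (transPart X).ncard * 1 := (mul_one _).symm
    _ ≤ (transPart X).ncard * (H : ℝ) ^ ε := by gcongr

/-- A finite set has the counting bound (its transcendental part is finite). [folklore] -/
theorem exists_bound_of_finite {X : Set (ι → ℝ)} (hX : X.Finite) {ε : ℝ} (hε : 0 ≤ ε) :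
    ∃ c : ℝ, ∀ H : ℕ, 1 ≤ H → (ratPointsLE (transPart X) H).Finite ∧
      ((ratPointsLE (transPart X) H).ncard : ℝ) ≤ c * (H : ℝ) ^ ε :=
  exists_bound_of_transPart_finite (hX.subset (transPart_subset X)) hε

/-- A set with empty transcendental part (e.g. `X ⊆ X^alg`) has the counting bound with
constant `0`. [folklore] -/
theorem exists_bound_of_transPart_eq_empty {X : Set (ι → ℝ)} (hX : transPart X = ∅) (ε : ℝ) :
    ∃ c : ℝ, ∀ H : ℕ, 1 ≤ H → (ratPointsLE (transPart X) H).Finite ∧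
      ((ratPointsLE (transPart X) H).ncard : ℝ) ≤ c * (H : ℝ) ^ ε := by
  refine ⟨0, fun H _ => ?_⟩
  have h0 : ratPointsLE (transPart X) H = ∅ :=
    Set.eq_empty_of_subset_empty (hX ▸ ratPointsLE_subset (transPart X) H)
  simp [h0]

/-- Monotonicity of the bound in the set along `X(ℚ, H) ⊆ X' ⊆ X`-type inclusions is false in
general, but the bound descends to subsets with the *same* algebraic-part behaviour: if
`X' ⊆ X` and `X'^trans ⊆ X^trans` — in particular if `X' = X ∖ E` with `E ⊆ X^alg` — a
bound for `X` is one for `X'`. [folklore] -/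
theorem exists_bound_of_transPart_subset [Finite ι] {X X' : Set (ι → ℝ)} {ε : ℝ}
    (h : transPart X' ⊆ transPart X)
    (hX : ∃ c : ℝ, ∀ H : ℕ, 1 ≤ H → (ratPointsLE (transPart X) H).Finite ∧
      ((ratPointsLE (transPart X) H).ncard : ℝ) ≤ c * (H : ℝ) ^ ε) :
    ∃ c : ℝ, ∀ H : ℕ, 1 ≤ H → (ratPointsLE (transPart X') H).Finite ∧
      ((ratPointsLE (transPart X') H).ncard : ℝ) ≤ c * (H : ℝ) ^ ε := by
  obtain ⟨c, hc⟩ := hX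
  refine ⟨c, fun H hH => ⟨ratPointsLE_transPart_finite _ _, ?_⟩⟩
  have hle : (ratPointsLE (transPart X') H).ncard ≤ (ratPointsLE (transPart X) H).ncard :=
    Set.ncard_le_ncard (ratPointsLE_mono_left h H) (ratPointsLE_finite _ _)
  calc ((ratPointsLE (transPart X') H).ncard : ℝ) ≤ (ratPointsLE (transPart X) H).ncard := by
        exact_mod_cast hle
    _ ≤ c * (H : ℝ) ^ ε := (hc H hH).2

end Reductions

/-! ### Interior points lie in the algebraic part (7.1, the case `k = n`) -/

section Interior

/-- Open boxes `∏ (aᵢ, bᵢ)` are semialgebraic. [folklore] -/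
theorem isSemialgebraic_pi_Ioo {n : ℕ} (a b : Fin n → ℝ) :
    IsSemialgebraic ℝ (Set.pi univ fun i => Ioo (a i) (b i) : Set (Fin n → ℝ)) := by
  have h : (Set.pi univ fun i => Ioo (a i) (b i) : Set (Fin n → ℝ)) =
      ⋂ i ∈ (Finset.univ : Finset (Fin n)),
        ({y : Fin n → ℝ | MvPolynomial.aeval y (MvPolynomial.C (a i) : MvPolynomial (Fin n) ℝ) <
            MvPolynomial.aeval y (MvPolynomial.X i : MvPolynomial (Fin n) ℝ)} ∩
          {y : Fin n → ℝ | MvPolynomial.aeval y (MvPolynomial.X i : MvPolynomial (Fin n) ℝ) <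
            MvPolynomial.aeval y (MvPolynomial.C (b i) : MvPolynomial (Fin n) ℝ)}) := by
    ext y
    simp [Set.mem_pi]
  rw [h]
  exact IsSemialgebraic.biInter _ _ fun i _ =>
    (isSemialgebraic_setOf_eval_lt _ _).inter (isSemialgebraic_setOf_eval_lt _ _)

/-- **Interior points lie in the algebraic part** (`n ≥ 1`): an open ball of `ℝⁿ` (sup norm: an
open box) inside `X` is a connected infinite semialgebraic subset of `X` (Pila–Wilkie 2006, 7.1:
*"If `x ∈ reg_k(X)`* [`k = n`] *… then `X` contains an open ball in `ℝⁿ` containing `x`.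
Therefore `x ∈ X^alg`"*). [cite: PilaWilkie2006, 7.1] -/
theorem interior_subset_algPart {n : ℕ} (hn : n ≠ 0) (X : Set (Fin n → ℝ)) :
    interior X ⊆ algPart X := by
  intro x hx
  rw [mem_interior_iff_mem_nhds, Metric.mem_nhds_iff] at hx
  obtain ⟨δ, hδ, hball⟩ := hx
  rw [mem_algPart_iff]
  set A : Set (Fin n → ℝ) := Set.pi univ fun i => Ioo (x i - δ) (x i + δ) with hA
  have hAball : A = Metric.ball x δ := by
    rw [ball_pi _ hδ, hA]
    congr 1
    ext i y
    rw [Real.ball_eq_Ioo]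
  have hxA : x ∈ A := fun i _ => ⟨by linarith, by linarith⟩
  refine ⟨A, hxA, hAball ▸ hball, isSemialgebraic_pi_Ioo _ _,
    ⟨⟨x, hxA⟩, (convex_pi fun _ _ => convex_Ioo _ _).isPreconnected⟩, ?_⟩
  -- a coordinate segment through `x` inside the box
  obtain ⟨i₀⟩ : Nonempty (Fin n) := ⟨⟨0, Nat.pos_of_ne_zero hn⟩⟩
  have himg : (fun t : ℝ => Function.update x i₀ t) '' Ioo (x i₀ - δ) (x i₀ + δ) ⊆ A := by
    rintro _ ⟨t, ht, rfl⟩ i -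
    show Function.update x i₀ t i ∈ Ioo (x i - δ) (x i + δ)
    by_cases hi : i = i₀
    · subst hi
      simpa using ht
    · rw [Function.update_of_ne hi]
      exact ⟨by linarith, by linarith⟩
  exact ((Ioo_infinite (by linarith)).image
    (Function.update_injective x i₀).injOn).mono himg

/-- Hence removing the interior does not change the count: `X^trans ⊆ (X ∖ interior X)^trans`
… more precisely `(X ∖ E)^trans ⊇ X^trans` for every `E ⊆ X^alg`, so a bound for `X ∖ E`
gives one for `X`. [cite: PilaWilkie2006, 7.1] -/
theorem transPart_subset_transPart_diff {ι : Type*} {X E : Set (ι → ℝ)} (hE : E ⊆ algPart X) :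
    transPart X ⊆ transPart (X \ E) := by
  intro x hx
  rw [mem_transPart_iff] at hx ⊢
  exact ⟨⟨hx.1, fun h => hx.2 (hE h)⟩, fun h => hx.2 (algPart_mono (fun _ hy => hy.1) h)⟩

end Interior

/-! ### The cases `n ≤ 1` of Theorem 1.8 -/

section LowDim

/-- **Theorem 1.8 for `n = 0`** (`ℝ⁰` is a point). [cite: PilaWilkie2006, Thm. 1.8 (case n = 0)] -/
theorem PilaWilkie2006_thm_1_8_zero (X : Set (Fin 0 → ℝ)) {ε : ℝ} (hε : 0 ≤ ε) :
    ∃ c : ℝ, ∀ H : ℕ, 1 ≤ H → (ratPointsLE (transPart X) H).Finite ∧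
      ((ratPointsLE (transPart X) H).ncard : ℝ) ≤ c * (H : ℝ) ^ ε :=
  exists_bound_of_finite (Set.toFinite X) hε

/-- **Theorem 1.8 for `n = 1` is o-minimality alone**: for any o-minimal structure on `ℝ` (no
field structure needed) and `X ⊆ ℝ¹` definable, `X` is a finite union of points and intervals,
so `X^trans` is finite (`transPart_finite_of_isFiniteUnionOfIntervals`) and
`N(X^trans, H) ≤ #X^trans · H^ε`. [cite: PilaWilkie2006, Thm. 1.8 (case n = 1)] -/
theorem PilaWilkie2006_thm_1_8_one {L : Language} [L.Structure ℝ] (hO : L.IsOMinimal ℝ)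
    (X : Set (Fin 1 → ℝ)) (hX : (univ : Set ℝ).Definable L X) {ε : ℝ} (hε : 0 ≤ ε) :
    ∃ c : ℝ, ∀ H : ℕ, 1 ≤ H → (ratPointsLE (transPart X) H).Finite ∧
      ((ratPointsLE (transPart X) H).ncard : ℝ) ≤ c * (H : ℝ) ^ ε := by
  have hdef : (univ : Set ℝ).Definable₁ L {t : ℝ | (fun _ : Fin 1 => t) ∈ X} := by
    unfold Set.Definable₁
    convert hX using 1
    ext x
    have hxe : (fun _ : Fin 1 => x 0) = x := funext fun i => congrArg x (Subsingleton.elim 0 i)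
    simp [hxe]
  exact exists_bound_of_transPart_finite
    (transPart_finite_of_isFiniteUnionOfIntervals (hO _ hdef)) hε

/-- The finiteness conjunct of `PilaWilkie2006_thm_1_8` is unconditional (`X(ℚ, H)` is finite
by Northcott on `ℚ`, `ratPointsLE_finite`); the content is the bound on the count. [folklore] -/
theorem PilaWilkie2006_thm_1_8_iff_ncard :
    PilaWilkie2006_thm_1_8 ↔
      ∀ (L : FirstOrder.Language.{0, 0}) [L.Structure ℝ],
        L.IsOMinimal ℝ →
        (univ : Set ℝ).Definable L {v : Fin 3 → ℝ | v 0 + v 1 = v 2} →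
        (univ : Set ℝ).Definable L {v : Fin 3 → ℝ | v 0 * v 1 = v 2} →
          ∀ (n : ℕ) (X : Set (Fin n → ℝ)), (univ : Set ℝ).Definable L X →
            ∀ ε : ℝ, 0 < ε → ∃ c : ℝ, ∀ H : ℕ, 1 ≤ H →
              ((ratPointsLE (transPart X) H).ncard : ℝ) ≤ c * (H : ℝ) ^ ε := by
  constructor
  · intro h L _ hO hadd hmul n X hX ε hε
    obtain ⟨c, hc⟩ := h L hO hadd hmul n X hX ε hε
    exact ⟨c, fun H hH => (hc H hH).2⟩
  · intro h L _ hO hadd hmul n X hX ε hε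
    obtain ⟨c, hc⟩ := h L hO hadd hmul n X hX ε hε
    exact ⟨c, fun H hH => ⟨ratPointsLE_transPart_finite _ _, hc H hH⟩⟩

end LowDim


/-! ### §7, 7.1: transport of `X^alg`, `X^trans`, `X(ℚ, H)` under bi-semialgebraic homeomorphisms -/

section Transport

variable {m n : ℕ}

/-- **Transport of the algebraic part.** Let `g : U → V` (`U ⊆ ℝᵐ`, `V ⊆ ℝⁿ`) be continuous with a
continuous inverse `g' : V → U` on the image side, both mapping semialgebraic subsets to
semialgebraic sets. Then for `X ⊆ U`, `(g(X))^alg = g(X^alg)`: connected infinite semialgebraic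
subsets correspond under `g` (Pila–Wilkie 2006, 7.1: *"the rational points of height `≤ T` are
stable under the maps `x ↦ ±x^{±1}`, as are the algebraic parts of a set"*).
[cite: PilaWilkie2006, 7.1] -/
theorem algPart_image_eq {U : Set (Fin m → ℝ)} {V : Set (Fin n → ℝ)}
    {g : (Fin m → ℝ) → Fin n → ℝ} {g' : (Fin n → ℝ) → Fin m → ℝ}
    (hgc : ContinuousOn g U) (hg'c : ContinuousOn g' V) (hUV : MapsTo g U V)
    (hleft : ∀ x ∈ U, g' (g x) = x) (hright : ∀ y ∈ V, g (g' y) = y)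
    (hg : ∀ A ⊆ U, IsSemialgebraic ℝ A → IsSemialgebraic ℝ (g '' A))
    (hg' : ∀ B ⊆ V, IsSemialgebraic ℝ B → IsSemialgebraic ℝ (g' '' B))
    {X : Set (Fin m → ℝ)} (hX : X ⊆ U) :
    algPart (g '' X) = g '' algPart X := by
  have hinjU : InjOn g U := fun x hx x' hx' h => by rw [← hleft x hx, ← hleft x' hx', h]
  have hinjV : InjOn g' V := fun y hy y' hy' h => by rw [← hright y hy, ← hright y' hy', h]
  apply Subset.antisymm
  · intro y hy
    rw [mem_algPart_iff] at hy
    obtain ⟨B, hyB, hBX, hBsa, hBconn, hBinf⟩ := hy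
    have hBV : B ⊆ V := hBX.trans ((image_mono hX).trans hUV.image_subset)
    have hyV : y ∈ V := hBV hyB
    have hB'X : g' '' B ⊆ X := by
      rintro _ ⟨b, hb, rfl⟩
      obtain ⟨x, hx, rfl⟩ := hBX hb
      rw [hleft x (hX hx)]
      exact hx
    refine ⟨g' y, mem_algPart_iff.mpr ⟨g' '' B, mem_image_of_mem g' hyB, hB'X, hg' B hBV hBsa,
      hBconn.image g' (hg'c.mono hBV), hBinf.image (hinjV.mono hBV)⟩, hright y hyV⟩
  · rintro _ ⟨x, hx, rfl⟩
    rw [mem_algPart_iff] at hx ⊢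
    obtain ⟨A, hxA, hAX, hAsa, hAconn, hAinf⟩ := hx
    have hAU : A ⊆ U := hAX.trans hX
    exact ⟨g '' A, mem_image_of_mem g hxA, image_mono hAX, hg A hAU hAsa,
      hAconn.image g (hgc.mono hAU), hAinf.image (hinjU.mono hAU)⟩

/-- **Transport of the transcendental part** under the same hypotheses:
`(g(X))^trans = g(X^trans)`. [cite: PilaWilkie2006, 7.1] -/
theorem transPart_image_eq {U : Set (Fin m → ℝ)} {V : Set (Fin n → ℝ)}
    {g : (Fin m → ℝ) → Fin n → ℝ} {g' : (Fin n → ℝ) → Fin m → ℝ}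
    (hgc : ContinuousOn g U) (hg'c : ContinuousOn g' V) (hUV : MapsTo g U V)
    (hleft : ∀ x ∈ U, g' (g x) = x) (hright : ∀ y ∈ V, g (g' y) = y)
    (hg : ∀ A ⊆ U, IsSemialgebraic ℝ A → IsSemialgebraic ℝ (g '' A))
    (hg' : ∀ B ⊆ V, IsSemialgebraic ℝ B → IsSemialgebraic ℝ (g' '' B))
    {X : Set (Fin m → ℝ)} (hX : X ⊆ U) :
    transPart (g '' X) = g '' transPart X := by
  have hinjX : InjOn g X := fun x hx x' hx' h => by rw [← hleft x (hX hx), ← hleft x' (hX hx'), h]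
  unfold transPart
  rw [algPart_image_eq hgc hg'c hUV hleft hright hg hg' hX, hinjX.image_sdiff_subset (algPart_subset X)]

/-- **Transport of `X(ℚ, H)`**: if `g` and `g'` preserve "all coordinates rational of height
`≤ H`" on `U`, resp. `V`, then `(g(Y))(ℚ, H) = g(Y(ℚ, H))` for `Y ⊆ U`.
[cite: PilaWilkie2006, 7.1] -/
theorem ratPointsLE_image_eq {U : Set (Fin m → ℝ)} {V : Set (Fin n → ℝ)}
    {g : (Fin m → ℝ) → Fin n → ℝ} {g' : (Fin n → ℝ) → Fin m → ℝ} (hUV : MapsTo g U V)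
    (hleft : ∀ x ∈ U, g' (g x) = x) {H : ℕ}
    (hrat : ∀ x ∈ U, (∀ i, ∃ q : ℚ, (q : ℝ) = x i ∧ Height.mulHeight₁ q ≤ H) →
      ∀ j, ∃ q : ℚ, (q : ℝ) = g x j ∧ Height.mulHeight₁ q ≤ H)
    (hrat' : ∀ y ∈ V, (∀ j, ∃ q : ℚ, (q : ℝ) = y j ∧ Height.mulHeight₁ q ≤ H) →
      ∀ i, ∃ q : ℚ, (q : ℝ) = g' y i ∧ Height.mulHeight₁ q ≤ H)
    {Y : Set (Fin m → ℝ)} (hY : Y ⊆ U) :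
    ratPointsLE (g '' Y) H = g '' ratPointsLE Y H := by
  apply Subset.antisymm
  · rintro y ⟨⟨x, hx, rfl⟩, hyq⟩
    refine ⟨x, ⟨hx, ?_⟩, rfl⟩
    have h := hrat' (g x) (hUV (hY hx)) hyq
    rwa [hleft x (hY hx)] at h
  · rintro _ ⟨x, ⟨hx, hxq⟩, rfl⟩
    exact ⟨mem_image_of_mem g hx, hrat x (hY hx) hxq⟩

/-- **The count is invariant**: under all the hypotheses above,
`N((g X)^trans, H) = N(X^trans, H)`. [cite: PilaWilkie2006, 7.1] -/
theorem ncard_ratPointsLE_transPart_image_eq {U : Set (Fin m → ℝ)} {V : Set (Fin n → ℝ)}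
    {g : (Fin m → ℝ) → Fin n → ℝ} {g' : (Fin n → ℝ) → Fin m → ℝ}
    (hgc : ContinuousOn g U) (hg'c : ContinuousOn g' V) (hUV : MapsTo g U V)
    (hleft : ∀ x ∈ U, g' (g x) = x) (hright : ∀ y ∈ V, g (g' y) = y)
    (hg : ∀ A ⊆ U, IsSemialgebraic ℝ A → IsSemialgebraic ℝ (g '' A))
    (hg' : ∀ B ⊆ V, IsSemialgebraic ℝ B → IsSemialgebraic ℝ (g' '' B)) {H : ℕ}
    (hrat : ∀ x ∈ U, (∀ i, ∃ q : ℚ, (q : ℝ) = x i ∧ Height.mulHeight₁ q ≤ H) →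
      ∀ j, ∃ q : ℚ, (q : ℝ) = g x j ∧ Height.mulHeight₁ q ≤ H)
    (hrat' : ∀ y ∈ V, (∀ j, ∃ q : ℚ, (q : ℝ) = y j ∧ Height.mulHeight₁ q ≤ H) →
      ∀ i, ∃ q : ℚ, (q : ℝ) = g' y i ∧ Height.mulHeight₁ q ≤ H)
    {X : Set (Fin m → ℝ)} (hX : X ⊆ U) :
    (ratPointsLE (transPart (g '' X)) H).ncard = (ratPointsLE (transPart X) H).ncard := by
  have hinjU : InjOn g U := fun x hx x' hx' h => by rw [← hleft x hx, ← hleft x' hx', h]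
  rw [transPart_image_eq hgc hg'c hUV hleft hright hg hg' hX,
    ratPointsLE_image_eq hUV hleft hrat hrat' ((transPart_subset X).trans hX)]
  exact Set.InjOn.ncard_image
    (hinjU.mono ((ratPointsLE_subset _ _).trans ((transPart_subset X).trans hX)))

/-- **Transfer of the counting bound** along such a map: a bound for `g(X)` is a bound for `X`.
[cite: PilaWilkie2006, 7.1] -/
theorem exists_bound_of_image {U : Set (Fin m → ℝ)} {V : Set (Fin n → ℝ)}
    {g : (Fin m → ℝ) → Fin n → ℝ} {g' : (Fin n → ℝ) → Fin m → ℝ}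
    (hgc : ContinuousOn g U) (hg'c : ContinuousOn g' V) (hUV : MapsTo g U V)
    (hleft : ∀ x ∈ U, g' (g x) = x) (hright : ∀ y ∈ V, g (g' y) = y)
    (hg : ∀ A ⊆ U, IsSemialgebraic ℝ A → IsSemialgebraic ℝ (g '' A))
    (hg' : ∀ B ⊆ V, IsSemialgebraic ℝ B → IsSemialgebraic ℝ (g' '' B))
    (hrat : ∀ H : ℕ, 1 ≤ H → ∀ x ∈ U, (∀ i, ∃ q : ℚ, (q : ℝ) = x i ∧ Height.mulHeight₁ q ≤ H) →
      ∀ j, ∃ q : ℚ, (q : ℝ) = g x j ∧ Height.mulHeight₁ q ≤ H)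
    (hrat' : ∀ H : ℕ, 1 ≤ H → ∀ y ∈ V, (∀ j, ∃ q : ℚ, (q : ℝ) = y j ∧ Height.mulHeight₁ q ≤ H) →
      ∀ i, ∃ q : ℚ, (q : ℝ) = g' y i ∧ Height.mulHeight₁ q ≤ H)
    {X : Set (Fin m → ℝ)} (hX : X ⊆ U) {ε : ℝ}
    (hb : ∃ c : ℝ, ∀ H : ℕ, 1 ≤ H → (ratPointsLE (transPart (g '' X)) H).Finite ∧
      ((ratPointsLE (transPart (g '' X)) H).ncard : ℝ) ≤ c * (H : ℝ) ^ ε) :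
    ∃ c : ℝ, ∀ H : ℕ, 1 ≤ H → (ratPointsLE (transPart X) H).Finite ∧
      ((ratPointsLE (transPart X) H).ncard : ℝ) ≤ c * (H : ℝ) ^ ε := by
  obtain ⟨c, hc⟩ := hb
  refine ⟨c, fun H hH => ⟨ratPointsLE_transPart_finite _ _, ?_⟩⟩
  rw [← ncard_ratPointsLE_transPart_image_eq hgc hg'c hUV hleft hright hg hg' (hrat H hH)
    (hrat' H hH) hX]
  exact (hc H hH).2

end Transport

/-! ### The maps `x ↦ ±x^{±1}` on one coordinate, and coordinate slices -/

section CoordinateMaps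

variable {n : ℕ}

/-- Negating one coordinate is an involution. [folklore] -/
theorem update_neg_update_neg (i : Fin n) (x : Fin n → ℝ) :
    Function.update (Function.update x i (-x i)) i (-Function.update x i (-x i) i) = x := by
  simp

/-- Inverting one (non-zero) coordinate is an involution. [folklore] -/
theorem update_inv_update_inv (i : Fin n) (x : Fin n → ℝ) :
    Function.update (Function.update x i (x i)⁻¹) i (Function.update x i (x i)⁻¹ i)⁻¹ = x := by
  simp

/-- Negating one coordinate is continuous. [folklore] -/
theorem continuous_update_neg (i : Fin n) :
    Continuous fun x : Fin n → ℝ => Function.update x i (-x i) :=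
  continuous_id.update i (continuous_apply i).neg

/-- Inverting one coordinate is continuous off the coordinate hyperplane. [folklore] -/
theorem continuousOn_update_inv (i : Fin n) :
    ContinuousOn (fun x : Fin n → ℝ => Function.update x i (x i)⁻¹) {x | x i ≠ 0} :=
  fun x hx => (continuousAt_id.update i (((continuous_apply i).continuousAt (x := x)).inv₀ hx)
    ).continuousWithinAt

/-- **Images of semialgebraic sets under negation of a coordinate are semialgebraic** (the map is
a polynomial involution, so the image is a polynomial preimage). [folklore] -/
theorem IsSemialgebraic.image_update_neg (i : Fin n) {A : Set (Fin n → ℝ)}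
    (hA : IsSemialgebraic ℝ A) :
    IsSemialgebraic ℝ ((fun x => Function.update x i (-x i)) '' A) := by
  classical
  set P : Fin n → MvPolynomial (Fin n) ℝ :=
    Function.update (fun j => MvPolynomial.X j) i (-MvPolynomial.X i) with hP
  have hpoly : ∀ x : Fin n → ℝ, (fun j => MvPolynomial.aeval x (P j)) =
      Function.update x i (-x i) := by
    intro x
    ext j
    by_cases hj : j = i
    · subst hj; simp [hP]
    · simp [hP, Function.update_of_ne hj]
  have heq : (fun x : Fin n → ℝ => Function.update x i (-x i)) '' A =
      (fun x : Fin n → ℝ => fun j => MvPolynomial.aeval x (P j)) ⁻¹' A := by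
    ext y
    simp only [mem_image, mem_preimage, hpoly]
    constructor
    · rintro ⟨x, hx, rfl⟩
      rwa [update_neg_update_neg]
    · exact fun hy => ⟨_, hy, update_neg_update_neg i y⟩
  rw [heq]
  exact hA.preimage_aeval P

/-- **Images of semialgebraic sets under inversion of a non-vanishing coordinate are
semialgebraic**: `{y : y_i ≠ 0, y[y_i ↦ 1/y_i] ∈ A}` is the projection of the semialgebraic set
`{(y, t) : t y_i = 1, y[y_i ↦ t] ∈ A}` (Tarski–Seidenberg, `tarski_seidenberg_real_holds`).
[folklore] -/
theorem IsSemialgebraic.image_update_inv (i : Fin n) {A : Set (Fin n → ℝ)}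
    (hA : IsSemialgebraic ℝ A) (hAU : A ⊆ {x | x i ≠ 0}) :
    IsSemialgebraic ℝ ((fun x => Function.update x i (x i)⁻¹) '' A) := by
  classical
  set S : Set (Fin (n + 1) → ℝ) := {z | z (Fin.last n) * z (Fin.castSucc i) = 1} ∩
    {z | Function.update (fun j => z (Fin.castSucc j)) i (z (Fin.last n)) ∈ A} with hS
  have hS1 : IsSemialgebraic ℝ {z : Fin (n + 1) → ℝ | z (Fin.last n) * z (Fin.castSucc i) = 1} := by
    convert isSemialgebraic_setOf_eval_eq_zero (k := ℝ) (R := ℝ)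
      (MvPolynomial.X (Fin.last n) * MvPolynomial.X (Fin.castSucc i) - 1 :
        MvPolynomial (Fin (n + 1)) ℝ) using 2 with z
    simp [sub_eq_zero]
  have hS2 : IsSemialgebraic ℝ
      {z : Fin (n + 1) → ℝ | Function.update (fun j => z (Fin.castSucc j)) i (z (Fin.last n)) ∈ A} := by
    set P : Fin n → MvPolynomial (Fin (n + 1)) ℝ :=
      Function.update (fun j => MvPolynomial.X (Fin.castSucc j)) i (MvPolynomial.X (Fin.last n))
      with hP
    have hpoly : ∀ z : Fin (n + 1) → ℝ, (fun j => MvPolynomial.aeval z (P j)) =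
        Function.update (fun j => z (Fin.castSucc j)) i (z (Fin.last n)) := by
      intro z
      ext j
      by_cases hj : j = i
      · subst hj; simp [hP]
      · simp [hP, Function.update_of_ne hj]
    have := hA.preimage_aeval P
    simpa only [preimage, hpoly] using this
  have hTS := tarski_seidenberg_real_holds (k := ℝ) (hS1.inter hS2)
  convert hTS using 1
  ext y
  constructor
  · rintro ⟨x, hx, rfl⟩
    have hxi : x i ≠ 0 := hAU hx
    set u : Fin n → ℝ := Function.update x i (x i)⁻¹ with hu
    refine ⟨Fin.snoc (α := fun _ => ℝ) u (x i), ⟨?_, ?_⟩, ?_⟩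
    · show Fin.snoc (α := fun _ => ℝ) u (x i) (Fin.last n) *
        Fin.snoc (α := fun _ => ℝ) u (x i) (Fin.castSucc i) = 1
      rw [Fin.snoc_last, Fin.snoc_castSucc, hu, Function.update_self]
      exact mul_inv_cancel₀ hxi
    · show Function.update (fun j => Fin.snoc (α := fun _ => ℝ) u (x i) (Fin.castSucc j)) i
        (Fin.snoc (α := fun _ => ℝ) u (x i) (Fin.last n)) ∈ A
      have h : Function.update (fun j => Fin.snoc (α := fun _ => ℝ) u (x i) (Fin.castSucc j)) i
          (Fin.snoc (α := fun _ => ℝ) u (x i) (Fin.last n)) = x := by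
        ext j
        by_cases hj : j = i
        · subst hj; simp
        · simp [Function.update_of_ne hj, hu]
      rw [h]
      exact hx
    · show Fin.init (Fin.snoc (α := fun _ => ℝ) u (x i)) = u
      exact Fin.init_snoc _ _
  · rintro ⟨z, ⟨hz1, hzA⟩, rfl⟩
    refine ⟨_, hzA, ?_⟩
    ext j
    by_cases hj : j = i
    · subst hj
      have h1 : z (Fin.last n) * z (Fin.castSucc j) = 1 := hz1
      simp only [Function.update_self, Function.comp_apply]
      exact inv_eq_of_mul_eq_one_right h1
    · simp [Function.update_of_ne hj]

/-- **Images of semialgebraic sets under a coordinate-slice embedding `x ↦ (x, x_i = c)` are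
semialgebraic.** [folklore] -/
theorem IsSemialgebraic.image_insertNth (i : Fin (n + 1)) (c : ℝ) {A : Set (Fin n → ℝ)}
    (hA : IsSemialgebraic ℝ A) :
    IsSemialgebraic ℝ ((fun x : Fin n → ℝ => (Fin.insertNth (α := fun _ => ℝ) i c x)) '' A) := by
  have heq : (fun x : Fin n → ℝ => (Fin.insertNth (α := fun _ => ℝ) i c x)) '' A =
      {y : Fin (n + 1) → ℝ | y i = c} ∩ (fun y : Fin (n + 1) → ℝ => y ∘ i.succAbove) ⁻¹' A := by
    ext y
    constructor
    · rintro ⟨x, hx, rfl⟩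
      refine ⟨by simp, ?_⟩
      show (fun j => Fin.insertNth (α := fun _ => ℝ) i c x (i.succAbove j)) ∈ A
      simpa using hx
    · rintro ⟨hyc, hyA⟩
      refine ⟨Fin.removeNth i y, hyA, ?_⟩
      have h := Fin.insertNth_self_removeNth (α := fun _ => ℝ) i y
      have hyc' : y i = c := hyc
      rw [hyc'] at h
      exact h
  rw [heq]
  refine IsSemialgebraic.inter ?_ (hA.preimage_comp _)
  convert isSemialgebraic_setOf_eval_eq_zero (k := ℝ) (R := ℝ)
    (MvPolynomial.X i - MvPolynomial.C c : MvPolynomial (Fin (n + 1)) ℝ) using 2 with y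
  simp [sub_eq_zero]

/-- **Images of semialgebraic subsets of a coordinate slice `{y_i = c}` under deletion of the
coordinate are semialgebraic** (a polynomial preimage under `x ↦ (x, x_i = c)`). [folklore] -/
theorem IsSemialgebraic.image_removeNth (i : Fin (n + 1)) (c : ℝ) {B : Set (Fin (n + 1) → ℝ)}
    (hB : IsSemialgebraic ℝ B) (hBV : B ⊆ {y | y i = c}) :
    IsSemialgebraic ℝ ((fun y : Fin (n + 1) → ℝ => (Fin.removeNth (α := fun _ => ℝ) i y)) '' B) := by
  set P : Fin (n + 1) → MvPolynomial (Fin n) ℝ :=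
    Fin.insertNth (α := fun _ => MvPolynomial (Fin n) ℝ) i (MvPolynomial.C c)
      (fun j => MvPolynomial.X j) with hP
  have hpoly : ∀ x : Fin n → ℝ, (fun j => MvPolynomial.aeval x (P j)) =
      Fin.insertNth (α := fun _ => ℝ) i c x := by
    intro x
    ext j
    refine Fin.succAboveCases i ?_ (fun k => ?_) j
    · simp [hP]
    · simp [hP]
  have heq : (fun y : Fin (n + 1) → ℝ => (Fin.removeNth (α := fun _ => ℝ) i y)) '' B =
      (fun x : Fin n → ℝ => fun j => MvPolynomial.aeval x (P j)) ⁻¹' B := by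
    ext x
    simp only [mem_image, mem_preimage, hpoly]
    constructor
    · rintro ⟨y, hy, rfl⟩
      have h := Fin.insertNth_self_removeNth (α := fun _ => ℝ) i y
      have hyc : y i = c := hBV hy
      rw [hyc] at h
      rwa [h]
    · intro hx
      exact ⟨_, hx, Fin.removeNth_insertNth (α := fun _ => ℝ) i c x⟩
  rw [heq]
  exact hB.preimage_aeval P

/-- Rational coordinates of bounded height are preserved by negating a coordinate
(`H(-q) = H(q)`). [folklore] -/
theorem forall_exists_rat_update_neg {H : ℕ} (i : Fin n) {x : Fin n → ℝ}
    (hx : ∀ j, ∃ q : ℚ, (q : ℝ) = x j ∧ Height.mulHeight₁ q ≤ H) :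
    ∀ j, ∃ q : ℚ, (q : ℝ) = Function.update x i (-x i) j ∧ Height.mulHeight₁ q ≤ H := by
  intro j
  by_cases hj : j = i
  · subst hj
    obtain ⟨q, hq, hqH⟩ := hx j
    exact ⟨-q, by simp [← hq], by rwa [Height.mulHeight₁_neg]⟩
  · rw [Function.update_of_ne hj]
    exact hx j

/-- Rational coordinates of bounded height are preserved by inverting a coordinate
(`H(1/q) = H(q)`). [folklore] -/
theorem forall_exists_rat_update_inv {H : ℕ} (i : Fin n) {x : Fin n → ℝ}
    (hx : ∀ j, ∃ q : ℚ, (q : ℝ) = x j ∧ Height.mulHeight₁ q ≤ H) :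
    ∀ j, ∃ q : ℚ, (q : ℝ) = Function.update x i (x i)⁻¹ j ∧ Height.mulHeight₁ q ≤ H := by
  intro j
  by_cases hj : j = i
  · subst hj
    obtain ⟨q, hq, hqH⟩ := hx j
    exact ⟨q⁻¹, by simp [← hq], by rwa [Height.mulHeight₁_inv]⟩
  · rw [Function.update_of_ne hj]
    exact hx j

/-- Rational coordinates of bounded height are preserved by deleting a coordinate. [folklore] -/
theorem forall_exists_rat_removeNth {H : ℕ} (i : Fin (n + 1)) {y : Fin (n + 1) → ℝ}
    (hy : ∀ j, ∃ q : ℚ, (q : ℝ) = y j ∧ Height.mulHeight₁ q ≤ H) :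
    ∀ j, ∃ q : ℚ, (q : ℝ) = Fin.removeNth (α := fun _ => ℝ) i y j ∧ Height.mulHeight₁ q ≤ H :=
  fun j => hy (i.succAbove j)

/-- Rational coordinates of bounded height `≤ H` (`H ≥ 1`) are preserved by inserting a coordinate
of value `c ∈ {-1, 0, 1}` (a rational of height `1`). [folklore] -/
theorem forall_exists_rat_insertNth {H : ℕ} (hH : 1 ≤ H) (i : Fin (n + 1)) {c : ℝ}
    (hc : ∃ q : ℚ, (q : ℝ) = c ∧ Height.mulHeight₁ q ≤ 1) {x : Fin n → ℝ}
    (hx : ∀ j, ∃ q : ℚ, (q : ℝ) = x j ∧ Height.mulHeight₁ q ≤ H) :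
    ∀ j, ∃ q : ℚ, (q : ℝ) = (Fin.insertNth (α := fun _ => ℝ) i c x) j ∧
      Height.mulHeight₁ q ≤ H := by
  intro j
  refine Fin.succAboveCases i ?_ (fun k => ?_) j
  · obtain ⟨q, hq, hq1⟩ := hc
    refine ⟨q, by simpa using hq, hq1.trans (by exact_mod_cast hH)⟩
  · simpa using hx k

end CoordinateMaps

/-! ### Definability in an expansion of the real field given by the graphs of `+` and `·` -/

section Definability

variable {L : Language} [L.Structure ℝ]

/-- A binary operation with definable graph, applied to definable functions of tuples, is a
definable function of tuples. [folklore] -/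
theorem definableFun_binop {α : Type*} [Finite α] {op : ℝ → ℝ → ℝ}
    (hop : (univ : Set ℝ).Definable L {v : Fin 3 → ℝ | op (v 0) (v 1) = v 2})
    {g h : (α → ℝ) → ℝ} (hg : (univ : Set ℝ).DefinableFun L g)
    (hh : (univ : Set ℝ).DefinableFun L h) :
    (univ : Set ℝ).DefinableFun L (fun v => op (g v) (h v)) := by
  have hsome : (univ : Set ℝ).DefinableMap L (fun w : Option α → ℝ => w ∘ some) :=
    fun j => definableFun_proj _
  have hF : (univ : Set ℝ).DefinableMap L
      (fun w : Option α → ℝ => (![g (w ∘ some), h (w ∘ some), w none] : Fin 3 → ℝ)) := by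
    intro i
    fin_cases i
    · exact hg.comp hsome
    · exact hh.comp hsome
    · exact definableFun_proj _
  have h := hop.preimage_map hF
  unfold Set.DefinableFun
  convert h using 1
  ext w
  simp [Function.tupleGraph]

/-- With the graph of `+` definable: sums of definable functions are definable. [folklore] -/
theorem definableFun_add {α : Type*} [Finite α]
    (hadd : (univ : Set ℝ).Definable L {v : Fin 3 → ℝ | v 0 + v 1 = v 2})
    {g h : (α → ℝ) → ℝ} (hg : (univ : Set ℝ).DefinableFun L g)
    (hh : (univ : Set ℝ).DefinableFun L h) :
    (univ : Set ℝ).DefinableFun L (fun v => g v + h v) :=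
  definableFun_binop hadd hg hh

/-- With the graph of `·` definable: products of definable functions are definable. [folklore] -/
theorem definableFun_mul {α : Type*} [Finite α]
    (hmul : (univ : Set ℝ).Definable L {v : Fin 3 → ℝ | v 0 * v 1 = v 2})
    {g h : (α → ℝ) → ℝ} (hg : (univ : Set ℝ).DefinableFun L g)
    (hh : (univ : Set ℝ).DefinableFun L h) :
    (univ : Set ℝ).DefinableFun L (fun v => g v * h v) :=
  definableFun_binop hmul hg hh

/-- With the graph of `+` definable: `v ↦ -g v` is definable (`-a = b ↔ a + b = 0`). [folklore] -/
theorem definableFun_neg {α : Type*} [Finite α]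
    (hadd : (univ : Set ℝ).Definable L {v : Fin 3 → ℝ | v 0 + v 1 = v 2})
    {g : (α → ℝ) → ℝ} (hg : (univ : Set ℝ).DefinableFun L g) :
    (univ : Set ℝ).DefinableFun L (fun v => -g v) := by
  have hsome : (univ : Set ℝ).DefinableMap L (fun w : Option α → ℝ => w ∘ some) :=
    fun j => definableFun_proj _
  have h := definable_setOf_eq' (definableFun_add hadd (hg.comp hsome) (definableFun_proj none)) (definableFun_const' (Option α) (0 : ℝ))
  unfold Set.DefinableFun
  convert h using 1
  ext w
  simp only [Function.tupleGraph, mem_setOf_eq]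
  constructor
  · intro hw; rw [← hw]; ring
  · intro hw; linarith

/-- With the graphs of `+`, `·` definable: `v ↦ (g v)⁻¹` is definable
(`a⁻¹ = b ↔ (a = 0 ∧ b = 0) ∨ a b = 1`, with `0⁻¹ = 0`). [folklore] -/
theorem definableFun_inv {α : Type*} [Finite α]
    (hmul : (univ : Set ℝ).Definable L {v : Fin 3 → ℝ | v 0 * v 1 = v 2})
    {g : (α → ℝ) → ℝ} (hg : (univ : Set ℝ).DefinableFun L g) :
    (univ : Set ℝ).DefinableFun L (fun v => (g v)⁻¹) := by
  have hsome : (univ : Set ℝ).DefinableMap L (fun w : Option α → ℝ => w ∘ some) :=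
    fun j => definableFun_proj _
  have hg' : (univ : Set ℝ).DefinableFun L (fun w : Option α → ℝ => g (w ∘ some)) := hg.comp hsome
  have hnone : (univ : Set ℝ).DefinableFun L (fun w : Option α → ℝ => w none) :=
    definableFun_proj none
  have h := definable_setOf_or
    (definable_setOf_and (definable_setOf_eq' hg' (definableFun_const' (Option α) (0 : ℝ)))
      (definable_setOf_eq' hnone (definableFun_const' (Option α) (0 : ℝ))))
    (definable_setOf_eq' (definableFun_mul hmul hg' hnone) (definableFun_const' (Option α) (1 : ℝ)))
  unfold Set.DefinableFun
  convert h using 1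
  ext w
  simp only [Function.tupleGraph, mem_setOf_eq]
  constructor
  · intro hw
    rw [← hw]
    by_cases h0 : g (w ∘ some) = 0
    · exact Or.inl ⟨h0, by rw [h0, inv_zero]⟩
    · exact Or.inr (mul_inv_cancel₀ h0)
  · rintro (⟨h0, h1⟩ | h1)
    · rw [h0, h1, inv_zero]
    · exact (eq_inv_of_mul_eq_one_right h1).symm

/-- With the graphs of `+`, `·` definable: the order `<` of `ℝ` is definable
(`a < b ↔ ∃ t ≠ 0, a + t² = b`). [folklore] -/
theorem definable_lt_of_field
    (hadd : (univ : Set ℝ).Definable L {v : Fin 3 → ℝ | v 0 + v 1 = v 2})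
    (hmul : (univ : Set ℝ).Definable L {v : Fin 3 → ℝ | v 0 * v 1 = v 2}) :
    (univ : Set ℝ).Definable L {v : Fin 2 → ℝ | v 0 < v 1} := by
  have h : (univ : Set ℝ).Definable L
      {v : Fin 2 → ℝ | ∃ t : ℝ, ¬ t = 0 ∧ v 0 + t * t = v 1} := by
    apply definable_setOf_exists
    refine definable_setOf_and (definable_setOf_not (definable_setOf_eq' (definableFun_proj _)
      (definableFun_const' _ (0 : ℝ)))) (definable_setOf_eq' ?_ (definableFun_proj _))
    exact definableFun_add hadd (definableFun_proj _)
      (definableFun_mul hmul (definableFun_proj _) (definableFun_proj _))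
  convert h using 1
  ext v
  simp only [mem_setOf_eq]
  constructor
  · intro hv
    refine ⟨Real.sqrt (v 1 - v 0), (Real.sqrt_pos.mpr (by linarith)).ne', ?_⟩
    rw [Real.mul_self_sqrt (by linarith)]
    ring
  · rintro ⟨t, ht, htv⟩
    have : 0 < t * t := mul_self_pos.mpr ht
    linarith

/-- Updating one coordinate by a definable function gives a definable map. [folklore] -/
theorem definableMap_update {α : Type*} [DecidableEq α] {F : (α → ℝ) → ℝ}
    (hF : (univ : Set ℝ).DefinableFun L F) (i : α) :
    (univ : Set ℝ).DefinableMap L (fun w : α → ℝ => Function.update w i (F w)) := by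
  intro j
  by_cases hj : j = i
  · subst hj
    simp only [Function.update_self]
    exact hF
  · simp only [Function.update_of_ne hj]
    exact definableFun_proj j

/-- Inserting a constant coordinate is a definable map `ℝⁿ → ℝⁿ⁺¹`. [folklore] -/
theorem definableMap_insertNth {n : ℕ} (i : Fin (n + 1)) (c : ℝ) :
    (univ : Set ℝ).DefinableMap L
      (fun x : Fin n → ℝ => (Fin.insertNth (α := fun _ => ℝ) i c x)) := by
  intro j
  refine Fin.succAboveCases i ?_ (fun k => ?_) j
  · simp only [Fin.insertNth_apply_same]
    exact definableFun_const' _ c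
  · simp only [Fin.insertNth_apply_succAbove]
    exact definableFun_proj k

/-- The image of a definable set under negation of a coordinate is definable. [folklore] -/
theorem Definable.image_update_neg
    (hadd : (univ : Set ℝ).Definable L {v : Fin 3 → ℝ | v 0 + v 1 = v 2})
    {n : ℕ} (i : Fin n) {X : Set (Fin n → ℝ)} (hX : (univ : Set ℝ).Definable L X) :
    (univ : Set ℝ).Definable L ((fun x => Function.update x i (-x i)) '' X) := by
  have heq : (fun x : Fin n → ℝ => Function.update x i (-x i)) '' X =
      (fun x : Fin n → ℝ => Function.update x i (-x i)) ⁻¹' X := by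
    ext y
    simp only [mem_image, mem_preimage]
    constructor
    · rintro ⟨x, hx, rfl⟩
      rwa [update_neg_update_neg]
    · exact fun hy => ⟨_, hy, update_neg_update_neg i y⟩
  rw [heq]
  exact hX.preimage_map (definableMap_update (definableFun_neg hadd (definableFun_proj i)) i)

/-- The image of a definable set off `{x_i = 0}` under inversion of the coordinate `i` is
definable. [folklore] -/
theorem Definable.image_update_inv
    (hmul : (univ : Set ℝ).Definable L {v : Fin 3 → ℝ | v 0 * v 1 = v 2})
    {n : ℕ} (i : Fin n) {X : Set (Fin n → ℝ)}
    (hX : (univ : Set ℝ).Definable L X) (hXU : X ⊆ {x | x i ≠ 0}) :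
    (univ : Set ℝ).Definable L ((fun x => Function.update x i (x i)⁻¹) '' X) := by
  have heq : (fun x : Fin n → ℝ => Function.update x i (x i)⁻¹) '' X =
      {y | ¬ y i = 0} ∩ (fun x : Fin n → ℝ => Function.update x i (x i)⁻¹) ⁻¹' X := by
    ext y
    simp only [mem_image, mem_preimage, mem_inter_iff, mem_setOf_eq]
    constructor
    · rintro ⟨x, hx, rfl⟩
      refine ⟨by simpa using hXU hx, ?_⟩
      rwa [update_inv_update_inv]
    · rintro ⟨-, hy⟩
      exact ⟨_, hy, update_inv_update_inv i y⟩
  rw [heq]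
  exact (definable_setOf_not (definable_setOf_eq' (definableFun_proj i)
    (definableFun_const' _ (0 : ℝ)))).inter
    (hX.preimage_map (definableMap_update (definableFun_inv hmul (definableFun_proj i)) i))

/-- The image of a definable subset of the slice `{y_i = c}` under deletion of the coordinate `i`
is definable. [folklore] -/
theorem Definable.image_removeNth {n : ℕ} (i : Fin (n + 1)) (c : ℝ) {X : Set (Fin (n + 1) → ℝ)}
    (hX : (univ : Set ℝ).Definable L X) (hXV : X ⊆ {y | y i = c}) :
    (univ : Set ℝ).Definable L
      ((fun y : Fin (n + 1) → ℝ => (Fin.removeNth (α := fun _ => ℝ) i y)) '' X) := by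
  have heq : (fun y : Fin (n + 1) → ℝ => (Fin.removeNth (α := fun _ => ℝ) i y)) '' X =
      (fun x : Fin n → ℝ => (Fin.insertNth (α := fun _ => ℝ) i c x)) ⁻¹' X := by
    ext x
    simp only [mem_image, mem_preimage]
    constructor
    · rintro ⟨y, hy, rfl⟩
      have h := Fin.insertNth_self_removeNth (α := fun _ => ℝ) i y
      have hyc : y i = c := hXV hy
      rw [hyc] at h
      rwa [h]
    · intro hx
      exact ⟨_, hx, Fin.removeNth_insertNth (α := fun _ => ℝ) i c x⟩
  rw [heq]
  exact hX.preimage_map (definableMap_insertNth i c)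

/-- Coordinate conditions `x_i < a`, `a < x_i` and `x_i = a` are definable. [folklore] -/
theorem definable_setOf_coord_lt
    (hadd : (univ : Set ℝ).Definable L {v : Fin 3 → ℝ | v 0 + v 1 = v 2})
    (hmul : (univ : Set ℝ).Definable L {v : Fin 3 → ℝ | v 0 * v 1 = v 2})
    {n : ℕ} (i : Fin n) (a : ℝ) :
    (univ : Set ℝ).Definable L {x : Fin n → ℝ | x i < a} :=
  definable_setOf_lt (definable_lt_of_field hadd hmul) (definableFun_proj i)
    (definableFun_const' _ a)

/-- See `definable_setOf_coord_lt`. [folklore] -/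
theorem definable_setOf_lt_coord
    (hadd : (univ : Set ℝ).Definable L {v : Fin 3 → ℝ | v 0 + v 1 = v 2})
    (hmul : (univ : Set ℝ).Definable L {v : Fin 3 → ℝ | v 0 * v 1 = v 2})
    {n : ℕ} (i : Fin n) (a : ℝ) :
    (univ : Set ℝ).Definable L {x : Fin n → ℝ | a < x i} :=
  definable_setOf_lt (definable_lt_of_field hadd hmul) (definableFun_const' _ a)
    (definableFun_proj i)

/-- See `definable_setOf_coord_lt`. [folklore] -/
theorem definable_setOf_coord_eq {n : ℕ} (i : Fin n) (a : ℝ) :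
    (univ : Set ℝ).Definable L {x : Fin n → ℝ | x i = a} :=
  definable_setOf_eq' (definableFun_proj i) (definableFun_const' _ a)

end Definability




/-! ### §7, 7.1: reduction of Theorem 1.8 to subsets of the open unit cube -/

section CubeReduction

variable {L : Language} [L.Structure ℝ]

/-- Transfer of the bound along negation of a coordinate. [cite: PilaWilkie2006, 7.1] -/
theorem exists_bound_of_image_update_neg {n : ℕ} (i : Fin n) {Y : Set (Fin n → ℝ)} {ε : ℝ}
    (hb : ∃ c : ℝ, ∀ H : ℕ, 1 ≤ H →
      (ratPointsLE (transPart ((fun x => Function.update x i (-x i)) '' Y)) H).Finite ∧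
      ((ratPointsLE (transPart ((fun x => Function.update x i (-x i)) '' Y)) H).ncard : ℝ) ≤
        c * (H : ℝ) ^ ε) :
    ∃ c : ℝ, ∀ H : ℕ, 1 ≤ H → (ratPointsLE (transPart Y) H).Finite ∧
      ((ratPointsLE (transPart Y) H).ncard : ℝ) ≤ c * (H : ℝ) ^ ε :=
  exists_bound_of_image (U := univ) (V := univ) (g' := fun x => Function.update x i (-x i))
    (continuous_update_neg i).continuousOn (continuous_update_neg i).continuousOn
    (mapsTo_univ _ _) (fun x _ => update_neg_update_neg i x) (fun y _ => update_neg_update_neg i y)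
    (fun _ _ hA => hA.image_update_neg i) (fun _ _ hB => hB.image_update_neg i)
    (fun _ _ _ _ hx => forall_exists_rat_update_neg i hx)
    (fun _ _ _ _ hy => forall_exists_rat_update_neg i hy) (subset_univ Y) hb

/-- Transfer of the bound along inversion of a non-vanishing coordinate.
[cite: PilaWilkie2006, 7.1] -/
theorem exists_bound_of_image_update_inv {n : ℕ} (i : Fin n) {Y : Set (Fin n → ℝ)}
    (hY : Y ⊆ {x | x i ≠ 0}) {ε : ℝ}
    (hb : ∃ c : ℝ, ∀ H : ℕ, 1 ≤ H →
      (ratPointsLE (transPart ((fun x => Function.update x i (x i)⁻¹) '' Y)) H).Finite ∧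
      ((ratPointsLE (transPart ((fun x => Function.update x i (x i)⁻¹) '' Y)) H).ncard : ℝ) ≤
        c * (H : ℝ) ^ ε) :
    ∃ c : ℝ, ∀ H : ℕ, 1 ≤ H → (ratPointsLE (transPart Y) H).Finite ∧
      ((ratPointsLE (transPart Y) H).ncard : ℝ) ≤ c * (H : ℝ) ^ ε := by
  refine exists_bound_of_image (U := {x | x i ≠ 0}) (V := {x | x i ≠ 0})
    (g' := fun x => Function.update x i (x i)⁻¹)
    (continuousOn_update_inv i) (continuousOn_update_inv i) (fun x hx => ?_)
    (fun x _ => update_inv_update_inv i x) (fun y _ => update_inv_update_inv i y)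
    (fun _ hA hAs => hAs.image_update_inv i hA) (fun _ hB hBs => hBs.image_update_inv i hB)
    (fun _ _ _ _ hx => forall_exists_rat_update_inv i hx)
    (fun _ _ _ _ hy => forall_exists_rat_update_inv i hy) hY hb
  show Function.update x i (x i)⁻¹ i ≠ 0
  simpa using hx

/-- Transfer of the bound from a coordinate slice `{y_i = c}`, `c ∈ {-1, 0, 1}` (a rational of
height `1`), to `ℝⁿ` by deleting the coordinate. [cite: PilaWilkie2006, 7.1] -/
theorem exists_bound_of_image_removeNth {n : ℕ} (i : Fin (n + 1)) {c : ℝ}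
    (hc : ∃ q : ℚ, (q : ℝ) = c ∧ Height.mulHeight₁ q ≤ 1) {Y : Set (Fin (n + 1) → ℝ)}
    (hY : Y ⊆ {y | y i = c}) {ε : ℝ}
    (hb : ∃ c' : ℝ, ∀ H : ℕ, 1 ≤ H →
      (ratPointsLE (transPart ((fun y : Fin (n + 1) → ℝ =>
        (Fin.removeNth (α := fun _ => ℝ) i y)) '' Y)) H).Finite ∧
      ((ratPointsLE (transPart ((fun y : Fin (n + 1) → ℝ =>
        (Fin.removeNth (α := fun _ => ℝ) i y)) '' Y)) H).ncard : ℝ) ≤ c' * (H : ℝ) ^ ε) :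
    ∃ c' : ℝ, ∀ H : ℕ, 1 ≤ H → (ratPointsLE (transPart Y) H).Finite ∧
      ((ratPointsLE (transPart Y) H).ncard : ℝ) ≤ c' * (H : ℝ) ^ ε := by
  refine exists_bound_of_image (U := {y | y i = c}) (V := univ)
    (g := fun y : Fin (n + 1) → ℝ => (Fin.removeNth (α := fun _ => ℝ) i y))
    (g' := fun x : Fin n → ℝ => (Fin.insertNth (α := fun _ => ℝ) i c x))
    (continuous_pi fun j => continuous_apply _).continuousOn
    ((continuous_const (y := c)).finInsertNth (A := fun _ : Fin (n + 1) => ℝ) i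
      continuous_id).continuousOn
    (mapsTo_univ _ _) (fun y hy => ?_) (fun x _ => Fin.removeNth_insertNth (α := fun _ => ℝ) i c x)
    (fun _ hA hAs => hAs.image_removeNth i c hA) (fun _ _ hBs => hBs.image_insertNth i c)
    (fun _ _ _ _ hy => forall_exists_rat_removeNth i hy)
    (fun _ hH _ _ hx => forall_exists_rat_insertNth hH i hc hx) hY hb
  have h := Fin.insertNth_self_removeNth (α := fun _ => ℝ) i y
  have hyc : y i = c := hy
  rw [hyc] at h
  exact h

/-- **Reduction of the counting theorem to subsets of open unit cubes** (Pila–Wilkie 2006, 7.1: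
*"Since the rational points of height `≤ T` are stable under the maps `x ↦ ±x^{±1}`, as are the
algebraic parts of a set, we may suppose that `Z ⊂ [0,1]ⁿ × ℝᵐ`, and so, by a suitable induction
on `n`, that `Z ⊂ (0,1)ⁿ × ℝᵐ`"*), for a single set over a fixed expansion of the real field in
which the graphs of `+` and `·` are definable: if every definable subset of every open unit cube
`(0,1)ⁿ` satisfies the bound `N(Y^trans, H) ≤ c(Y, ε) H^ε`, then so does every definable
`X ⊆ ℝⁿ`. Proof: induction on `n`; split `ℝⁿ` by the position of each coordinate relative to
`-1, 0, 1` (definable pieces, `definable_lt_of_field`); on the open pieces compose the coordinate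
maps `x_i ↦ -x_i`, `x_i ↦ 1/x_i` (bounds transfer: `exists_bound_of_image_update_neg/inv`), on
the slices `x_i = c` delete the coordinate and use the induction hypothesis
(`exists_bound_of_image_removeNth`); add up (`exists_bound_union`). [cite: PilaWilkie2006, 7.1] -/
theorem exists_bound_of_forall_unitCube
    (hadd : (univ : Set ℝ).Definable L {v : Fin 3 → ℝ | v 0 + v 1 = v 2})
    (hmul : (univ : Set ℝ).Definable L {v : Fin 3 → ℝ | v 0 * v 1 = v 2})
    (hcube : ∀ (n : ℕ) (Y : Set (Fin n → ℝ)), Y ⊆ Set.pi univ (fun _ => Ioo (0 : ℝ) 1) →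
      (univ : Set ℝ).Definable L Y → ∀ ε : ℝ, 0 < ε →
        ∃ c : ℝ, ∀ H : ℕ, 1 ≤ H → (ratPointsLE (transPart Y) H).Finite ∧
          ((ratPointsLE (transPart Y) H).ncard : ℝ) ≤ c * (H : ℝ) ^ ε)
    (n : ℕ) (X : Set (Fin n → ℝ)) (hX : (univ : Set ℝ).Definable L X) {ε : ℝ} (hε : 0 < ε) :
    ∃ c : ℝ, ∀ H : ℕ, 1 ≤ H → (ratPointsLE (transPart X) H).Finite ∧
      ((ratPointsLE (transPart X) H).ncard : ℝ) ≤ c * (H : ℝ) ^ ε := by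
  induction n with
  | zero => exact exists_bound_of_finite (Set.toFinite X) hε.le
  | succ n ih =>
    -- Step 1: sets avoiding the coordinate values `-1, 0, 1`, by induction on the number `j` of
    -- coordinates not yet known to lie in `(0, 1)`
    have step1 : ∀ j : ℕ, j ≤ n + 1 → ∀ Y : Set (Fin (n + 1) → ℝ),
        (univ : Set ℝ).Definable L Y →
        (∀ x ∈ Y, ∀ i : Fin (n + 1), x i ≠ -1 ∧ x i ≠ 0 ∧ x i ≠ 1) →
        (∀ x ∈ Y, ∀ i : Fin (n + 1), j ≤ (i : ℕ) → x i ∈ Ioo (0 : ℝ) 1) →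
        ∃ c : ℝ, ∀ H : ℕ, 1 ≤ H → (ratPointsLE (transPart Y) H).Finite ∧
          ((ratPointsLE (transPart Y) H).ncard : ℝ) ≤ c * (H : ℝ) ^ ε := by
      intro j
      induction j with
      | zero =>
        intro _ Y hY _ hI
        exact hcube (n + 1) Y (fun x hx i _ => hI x hx i (Nat.zero_le _)) hY ε hε
      | succ j ihj =>
        intro hj Y hY hG hI
        have hjn : j < n + 1 := hj
        set i₀ : Fin (n + 1) := ⟨j, hjn⟩ with hi₀
        have hI' : ∀ x ∈ Y, ∀ i : Fin (n + 1), i ≠ i₀ → j ≤ (i : ℕ) → x i ∈ Ioo (0 : ℝ) 1 := by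
          intro x hx i hi hji
          refine hI x hx i (lt_of_le_of_ne hji fun h => hi (Fin.ext ?_))
          rw [hi₀]
          exact h.symm
        -- the four pieces
        set Y₁ : Set (Fin (n + 1) → ℝ) := Y ∩ ({x | 0 < x i₀} ∩ {x | x i₀ < 1}) with hY₁
        set Y₂ : Set (Fin (n + 1) → ℝ) := Y ∩ {x | 1 < x i₀} with hY₂
        set Y₃ : Set (Fin (n + 1) → ℝ) := Y ∩ ({x | -1 < x i₀} ∩ {x | x i₀ < 0}) with hY₃
        set Y₄ : Set (Fin (n + 1) → ℝ) := Y ∩ {x | x i₀ < -1} with hY₄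
        have hcov : Y = ((Y₁ ∪ Y₂) ∪ Y₃) ∪ Y₄ := by
          apply Subset.antisymm _
          · simp only [hY₁, hY₂, hY₃, hY₄, union_subset_iff]
            exact ⟨⟨⟨inter_subset_left, inter_subset_left⟩, inter_subset_left⟩, inter_subset_left⟩
          intro x hx
          obtain ⟨h1, h0, h1'⟩ := hG x hx i₀
          simp only [hY₁, hY₂, hY₃, hY₄, mem_union, mem_inter_iff, mem_setOf_eq]
          rcases lt_or_gt_of_ne h1 with ha | ha
          · exact Or.inr ⟨hx, ha⟩
          rcases lt_or_gt_of_ne h0 with hb | hb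
          · exact Or.inl (Or.inr ⟨hx, ha, hb⟩)
          rcases lt_or_gt_of_ne h1' with hc | hc
          · exact Or.inl (Or.inl (Or.inl ⟨hx, hb, hc⟩))
          · exact Or.inl (Or.inl (Or.inr ⟨hx, hc⟩))
        have hlt := definable_lt_of_field hadd hmul
        -- the generic step: a piece whose image under a coordinate map has `j`-th coordinate in
        -- `(0,1)` and the others unchanged
        have hnext : ∀ (Z : Set (Fin (n + 1) → ℝ)), (univ : Set ℝ).Definable L Z →
            (∀ z ∈ Z, ∃ x ∈ Y, (∀ i, i ≠ i₀ → z i = x i) ∧ z i₀ ∈ Ioo (0 : ℝ) 1) →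
            ∃ c : ℝ, ∀ H : ℕ, 1 ≤ H → (ratPointsLE (transPart Z) H).Finite ∧
              ((ratPointsLE (transPart Z) H).ncard : ℝ) ≤ c * (H : ℝ) ^ ε := by
          intro Z hZ hZY
          refine ihj hjn.le Z hZ (fun z hz i => ?_) (fun z hz i hji => ?_)
          · obtain ⟨x, hx, hzx, hz0⟩ := hZY z hz
            by_cases hi : i = i₀
            · subst hi
              exact ⟨by linarith [hz0.1], hz0.1.ne', hz0.2.ne⟩
            · rw [hzx i hi]
              exact hG x hx i
          · obtain ⟨x, hx, hzx, hz0⟩ := hZY z hz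
            by_cases hi : i = i₀
            · subst hi
              exact hz0
            · rw [hzx i hi]
              exact hI' x hx i hi hji
        -- piece 1: already in `(0,1)`
        have hb₁ : ∃ c : ℝ, ∀ H : ℕ, 1 ≤ H → (ratPointsLE (transPart Y₁) H).Finite ∧
            ((ratPointsLE (transPart Y₁) H).ncard : ℝ) ≤ c * (H : ℝ) ^ ε :=
          hnext Y₁ (hY.inter ((definable_setOf_lt_coord hadd hmul i₀ 0).inter
            (definable_setOf_coord_lt hadd hmul i₀ 1)))
            fun z hz => ⟨z, hz.1, fun _ _ => rfl, hz.2.1, hz.2.2⟩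
        -- piece 2: `x_{i₀} > 1`, invert
        have hY₂U : Y₂ ⊆ {x | x i₀ ≠ 0} := fun x hx => by
          have : (1 : ℝ) < x i₀ := hx.2
          exact ne_of_gt (by linarith)
        have hb₂ : ∃ c : ℝ, ∀ H : ℕ, 1 ≤ H → (ratPointsLE (transPart Y₂) H).Finite ∧
            ((ratPointsLE (transPart Y₂) H).ncard : ℝ) ≤ c * (H : ℝ) ^ ε := by
          refine exists_bound_of_image_update_inv i₀ hY₂U (hnext _
            (Definable.image_update_inv hmul i₀ (hY.inter (definable_setOf_lt_coord hadd hmul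
              i₀ 1)) hY₂U) ?_)
          rintro _ ⟨x, hx, rfl⟩
          have hx1 : (1 : ℝ) < x i₀ := hx.2
          refine ⟨x, hx.1, fun i hi => by simp [Function.update_of_ne hi], ?_⟩
          show Function.update x i₀ (x i₀)⁻¹ i₀ ∈ Ioo (0 : ℝ) 1
          rw [Function.update_self]
          exact ⟨inv_pos.mpr (by linarith), inv_lt_one_of_one_lt₀ hx1⟩
        -- piece 3: `-1 < x_{i₀} < 0`, negate
        have hb₃ : ∃ c : ℝ, ∀ H : ℕ, 1 ≤ H → (ratPointsLE (transPart Y₃) H).Finite ∧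
            ((ratPointsLE (transPart Y₃) H).ncard : ℝ) ≤ c * (H : ℝ) ^ ε := by
          refine exists_bound_of_image_update_neg i₀ (hnext _
            (Definable.image_update_neg hadd i₀ (hY.inter ((definable_setOf_lt_coord hadd hmul
              i₀ (-1)).inter (definable_setOf_coord_lt hadd hmul i₀ 0)))) ?_)
          rintro _ ⟨x, hx, rfl⟩
          obtain ⟨hxa, hxb⟩ : (-1 : ℝ) < x i₀ ∧ x i₀ < 0 := hx.2
          refine ⟨x, hx.1, fun i hi => by simp [Function.update_of_ne hi], ?_⟩
          show Function.update x i₀ (-x i₀) i₀ ∈ Ioo (0 : ℝ) 1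
          rw [Function.update_self]
          exact ⟨by linarith, by linarith⟩
        -- piece 4: `x_{i₀} < -1`, negate then invert
        have hb₄ : ∃ c : ℝ, ∀ H : ℕ, 1 ≤ H → (ratPointsLE (transPart Y₄) H).Finite ∧
            ((ratPointsLE (transPart Y₄) H).ncard : ℝ) ≤ c * (H : ℝ) ^ ε := by
          set Y₄' : Set (Fin (n + 1) → ℝ) := (fun x => Function.update x i₀ (-x i₀)) '' Y₄
            with hY₄'
          have hY₄'d : (univ : Set ℝ).Definable L Y₄' :=
            Definable.image_update_neg hadd i₀ (hY.inter (definable_setOf_coord_lt hadd hmul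
              i₀ (-1)))
          have hY₄'U : Y₄' ⊆ {x | x i₀ ≠ 0} := by
            rintro _ ⟨x, hx, rfl⟩
            have : x i₀ < -1 := hx.2
            show Function.update x i₀ (-x i₀) i₀ ≠ 0
            rw [Function.update_self]
            linarith
          refine exists_bound_of_image_update_neg i₀ (exists_bound_of_image_update_inv i₀ hY₄'U
            (hnext _ (Definable.image_update_inv hmul i₀ hY₄'d hY₄'U) ?_))
          rintro _ ⟨_, ⟨x, hx, rfl⟩, rfl⟩
          have hxa : x i₀ < -1 := hx.2
          refine ⟨x, hx.1, fun i hi => by simp [Function.update_of_ne hi], ?_⟩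
          show Function.update (Function.update x i₀ (-x i₀)) i₀
            (Function.update x i₀ (-x i₀) i₀)⁻¹ i₀ ∈ Ioo (0 : ℝ) 1
          rw [Function.update_self, Function.update_self]
          have h1 : (1 : ℝ) < -x i₀ := by linarith
          exact ⟨inv_pos.mpr (by linarith), inv_lt_one_of_one_lt₀ h1⟩
        rw [hcov]
        exact exists_bound_union (exists_bound_union (exists_bound_union hb₁ hb₂) hb₃) hb₄
    -- Step 2: split off the coordinate slices `x_i ∈ {-1, 0, 1}`
    set G : Set (Fin (n + 1) → ℝ) :=
      ⋂ i : Fin (n + 1), ({x | ¬ x i = -1} ∩ ({x | ¬ x i = 0} ∩ {x | ¬ x i = 1})) with hGdef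
    have hGd : (univ : Set ℝ).Definable L G :=
      Set.definable_iInter_of_finite fun i =>
        (definable_setOf_not (definable_setOf_coord_eq i (-1))).inter
          ((definable_setOf_not (definable_setOf_coord_eq i 0)).inter
            (definable_setOf_not (definable_setOf_coord_eq i 1)))
    have hbG : ∃ c : ℝ, ∀ H : ℕ, 1 ≤ H → (ratPointsLE (transPart (X ∩ G)) H).Finite ∧
        ((ratPointsLE (transPart (X ∩ G)) H).ncard : ℝ) ≤ c * (H : ℝ) ^ ε := by
      refine step1 (n + 1) le_rfl (X ∩ G) (hX.inter hGd) (fun x hx i => ?_)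
        (fun x _ i hi => absurd i.isLt (not_lt.mpr hi))
      have h := mem_iInter.mp hx.2 i
      exact ⟨h.1, h.2.1, h.2.2⟩
    -- slices
    have hslice : ∀ (i : Fin (n + 1)) (c : ℝ), (∃ q : ℚ, (q : ℝ) = c ∧ Height.mulHeight₁ q ≤ 1) →
        ∃ c' : ℝ, ∀ H : ℕ, 1 ≤ H → (ratPointsLE (transPart (X ∩ {x | x i = c})) H).Finite ∧
          ((ratPointsLE (transPart (X ∩ {x | x i = c})) H).ncard : ℝ) ≤ c' * (H : ℝ) ^ ε := by
      intro i c hc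
      have hsub : X ∩ {x | x i = c} ⊆ {y | y i = c} := inter_subset_right
      exact exists_bound_of_image_removeNth i hc hsub
        (ih _ (Definable.image_removeNth i c (hX.inter (definable_setOf_coord_eq i c)) hsub))
    have hq1 : ∃ q : ℚ, (q : ℝ) = (-1 : ℝ) ∧ Height.mulHeight₁ q ≤ 1 :=
      ⟨-1, by push_cast; ring, by rw [Height.mulHeight₁_neg, Height.mulHeight₁_one]⟩
    have hq0 : ∃ q : ℚ, (q : ℝ) = (0 : ℝ) ∧ Height.mulHeight₁ q ≤ 1 :=
      ⟨0, by push_cast; ring, by rw [Height.mulHeight₁_zero]⟩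
    have hq1' : ∃ q : ℚ, (q : ℝ) = (1 : ℝ) ∧ Height.mulHeight₁ q ≤ 1 :=
      ⟨1, by push_cast; ring, by rw [Height.mulHeight₁_one]⟩
    have hbS : ∃ c : ℝ, ∀ H : ℕ, 1 ≤ H →
        (ratPointsLE (transPart (⋃ i ∈ (Finset.univ : Finset (Fin (n + 1))),
          ((X ∩ {x | x i = -1}) ∪ (X ∩ {x | x i = 0})) ∪ (X ∩ {x | x i = 1}))) H).Finite ∧
        ((ratPointsLE (transPart (⋃ i ∈ (Finset.univ : Finset (Fin (n + 1))),
          ((X ∩ {x | x i = -1}) ∪ (X ∩ {x | x i = 0})) ∪ (X ∩ {x | x i = 1}))) H).ncard : ℝ) ≤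
          c * (H : ℝ) ^ ε :=
      exists_bound_biUnion Finset.univ _ fun i _ =>
        exists_bound_union (exists_bound_union (hslice i (-1) hq1) (hslice i 0 hq0))
          (hslice i 1 hq1')
    have hcov : X = (X ∩ G) ∪ ⋃ i ∈ (Finset.univ : Finset (Fin (n + 1))),
        ((X ∩ {x | x i = -1}) ∪ (X ∩ {x | x i = 0})) ∪ (X ∩ {x | x i = 1}) := by
      apply Subset.antisymm _
      · refine union_subset inter_subset_left (iUnion₂_subset fun i _ => ?_)
        exact union_subset (union_subset inter_subset_left inter_subset_left) inter_subset_left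
      intro x hx
      by_cases hxG : x ∈ G
      · exact Or.inl ⟨hx, hxG⟩
      · right
        simp only [hGdef, mem_iInter, mem_inter_iff, mem_setOf_eq, not_forall, not_and,
          not_not] at hxG
        obtain ⟨i, hi⟩ := hxG
        simp only [mem_iUnion, Finset.mem_univ, exists_true_left, mem_union, mem_inter_iff,
          mem_setOf_eq]
        refine ⟨i, ?_⟩
        by_cases h1 : x i = -1
        · exact Or.inl (Or.inl ⟨hx, h1⟩)
        by_cases h0 : x i = 0
        · exact Or.inl (Or.inr ⟨hx, h0⟩)
        · exact Or.inr ⟨hx, hi h1 h0⟩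
    rw [hcov]
    exact exists_bound_union hbG hbS

/-- **Theorem 1.8 follows from its restriction to subsets of open unit cubes** (the first
reduction of Pila–Wilkie 2006, 7.1). [cite: PilaWilkie2006, 7.1] -/
theorem PilaWilkie2006_thm_1_8_of_unitCube
    (hcube : ∀ (L : FirstOrder.Language.{0, 0}) [L.Structure ℝ],
      L.IsOMinimal ℝ →
      (univ : Set ℝ).Definable L {v : Fin 3 → ℝ | v 0 + v 1 = v 2} →
      (univ : Set ℝ).Definable L {v : Fin 3 → ℝ | v 0 * v 1 = v 2} →
        ∀ (n : ℕ) (Y : Set (Fin n → ℝ)), Y ⊆ Set.pi univ (fun _ => Ioo (0 : ℝ) 1) →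
          (univ : Set ℝ).Definable L Y → ∀ ε : ℝ, 0 < ε →
            ∃ c : ℝ, ∀ H : ℕ, 1 ≤ H → (ratPointsLE (transPart Y) H).Finite ∧
              ((ratPointsLE (transPart Y) H).ncard : ℝ) ≤ c * (H : ℝ) ^ ε) :
    PilaWilkie2006_thm_1_8 := fun L _ hO hadd hmul n X hX _ hε =>
  exists_bound_of_forall_unitCube hadd hmul (hcube L hO hadd hmul) n X hX hε

end CubeReduction

/-! ### The derivative as a first-order condition over `ℝ` -/

/-- `ε`–`δ` form of `HasDerivAt` over `ℝ`, without absolute values: `f` has derivative `a` at `x`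
iff for every `c > 0` there is `δ > 0` with `(f(x+h) − f(x) − h a)² ≤ c² h²` for `|h| < δ`.
[folklore] -/
theorem hasDerivAt_iff_forall_exists_sq {f : ℝ → ℝ} {a x : ℝ} :
    HasDerivAt f a x ↔ ∀ c : ℝ, 0 < c → ∃ δ : ℝ, 0 < δ ∧ ∀ h : ℝ, -δ < h → h < δ →
      (f (x + h) - f x - h * a) * (f (x + h) - f x - h * a) ≤ c * c * (h * h) := by
  rw [hasDerivAt_iff_isLittleO_nhds_zero, Asymptotics.isLittleO_iff]
  refine forall_congr' fun c => ⟨fun H hc => ?_, fun H hc => ?_⟩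
  · have h := H hc
    rw [Metric.eventually_nhds_iff] at h
    obtain ⟨δ, hδ, hh⟩ := h
    refine ⟨δ, hδ, fun h h1 h2 => ?_⟩
    have hd : dist h 0 < δ := by
      rw [dist_zero_right, Real.norm_eq_abs, abs_lt]
      exact ⟨h1, h2⟩
    have key := hh hd
    simp only [Real.norm_eq_abs, smul_eq_mul] at key
    have hc0 : 0 ≤ c * |h| := by positivity
    have : |f (x + h) - f x - h * a| * |f (x + h) - f x - h * a| ≤ (c * |h|) * (c * |h|) :=
      mul_le_mul key key (abs_nonneg _) hc0
    calc (f (x + h) - f x - h * a) * (f (x + h) - f x - h * a)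
        = |f (x + h) - f x - h * a| * |f (x + h) - f x - h * a| := (abs_mul_abs_self _).symm
      _ ≤ (c * |h|) * (c * |h|) := this
      _ = c * c * (h * h) := by rw [mul_mul_mul_comm, abs_mul_abs_self]
  · obtain ⟨δ, hδ, hh⟩ := H hc
    rw [Metric.eventually_nhds_iff]
    refine ⟨δ, hδ, fun h hd => ?_⟩
    rw [dist_zero_right, Real.norm_eq_abs, abs_lt] at hd
    have key := hh h hd.1 hd.2
    simp only [Real.norm_eq_abs, smul_eq_mul]
    have hc0 : 0 ≤ c * |h| := by positivity
    have h2 : |f (x + h) - f x - h * a| * |f (x + h) - f x - h * a| ≤ (c * |h|) * (c * |h|) := by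
      rw [abs_mul_abs_self, mul_mul_mul_comm, abs_mul_abs_self]
      exact key
    exact (mul_self_le_mul_self_iff (abs_nonneg _) hc0).mpr h2

/-! ### Definability of the derivative in expansions of the real field -/

section Definability

variable {L : Language} [L.Structure ℝ] {β : Type}

/-- `Fin.snoc` of a definable map and a definable function is a definable map. [folklore] -/
theorem definableMap_snoc {γ : Type*} {n : ℕ} {P : (γ → ℝ) → Fin n → ℝ} {t : (γ → ℝ) → ℝ}
    (hP : (univ : Set ℝ).DefinableMap L P) (ht : (univ : Set ℝ).DefinableFun L t) :
    (univ : Set ℝ).DefinableMap L (fun v => (Fin.snoc (P v) (t v) : Fin (n + 1) → ℝ)) := by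
  intro i
  refine Fin.lastCases ?_ (fun j => ?_) i
  · simp only [Fin.snoc_last]
    exact ht
  · simp only [Fin.snoc_castSucc]
    exact hP j

/-- Restriction of tuples along a map of index types is a definable map. [folklore] -/
theorem definableMap_comp_index {γ δ : Type*} (σ : δ → γ) :
    (univ : Set ℝ).DefinableMap L (fun v : γ → ℝ => v ∘ σ) :=
  fun j => definableFun_proj (σ j)

/-- **A single function with definable graph is a definable family** (constant in the
parameters): the closure property `hΦ` used throughout this file holds for `Φ v x = f x`.
[folklore] -/
theorem definableFamily_of_graph {f : ℝ → ℝ}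
    (hf : (univ : Set ℝ).Definable L {v : Fin 2 → ℝ | v 1 = f (v 0)}) :
    ∀ (γ : Type) [Finite γ] (q : (γ → ℝ) → β → ℝ) (t : (γ → ℝ) → ℝ),
      (univ : Set ℝ).DefinableMap L q → (univ : Set ℝ).DefinableFun L t →
        (univ : Set ℝ).DefinableFun L (fun u => (fun (_ : β → ℝ) (x : ℝ) => f x) (q u) (t u)) :=
  fun _ _ _ _ _ ht => definableFun_apply hf ht

/-- The graph `{(x, y) | y = Φ v x}` of each member of a definable family is definable (the
form consumed by the monotonicity theorem). [folklore] -/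
theorem definable_graph_of_family {Φ : (β → ℝ) → ℝ → ℝ}
    (hΦ : ∀ (γ : Type) [Finite γ] (q : (γ → ℝ) → β → ℝ) (t : (γ → ℝ) → ℝ),
      (univ : Set ℝ).DefinableMap L q → (univ : Set ℝ).DefinableFun L t →
        (univ : Set ℝ).DefinableFun L (fun u => Φ (q u) (t u)))
    (v : β → ℝ) :
    (univ : Set ℝ).Definable L {w : Fin 2 → ℝ | w 1 = Φ v (w 0)} := by
  have h := hΦ (Fin 1) (fun _ => v) (fun u => u 0) (fun i => definableFun_const' _ (v i))
    (definableFun_proj 0)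
  unfold Set.DefinableFun at h
  have h2 := h.preimage_comp (fun o : Option (Fin 1) => (o.elim 1 fun _ => 0 : Fin 2))
  convert h2 using 1
  ext w
  simp only [mem_setOf_eq, mem_preimage, Function.tupleGraph, Function.comp_def]
  constructor
  · intro hw
    simpa using hw.symm
  · intro hw
    simpa using hw.symm

/-- With the graph of `+` definable: differences of definable functions are definable.
[folklore] -/
theorem definableFun_sub {γ : Type*} [Finite γ]
    (hadd : (univ : Set ℝ).Definable L {v : Fin 3 → ℝ | v 0 + v 1 = v 2})
    {g h : (γ → ℝ) → ℝ} (hg : (univ : Set ℝ).DefinableFun L g)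
    (hh : (univ : Set ℝ).DefinableFun L h) :
    (univ : Set ℝ).DefinableFun L (fun v => g v - h v) := by
  have h1 := definableFun_add hadd hg (definableFun_neg hadd hh)
  simpa [sub_eq_add_neg] using h1


/-- **The derivative relation is definable**: for a definable family `Φ` and definable tuple
functions `q`, `t`, `a`, the set of `u` with `HasDerivAt (Φ (q u)) (a u) (t u)` is definable
(the `ε`–`δ` definition `hasDerivAt_iff_forall_exists_sq` is first order in `+, ·, <, Φ`;
van den Dries 1998, Ch. 7, (1.1): *"differentiability is a first-order property"*).
[cite: Dries1998, Ch. 7 (1.1)] -/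
theorem definable_setOf_hasDerivAt [Finite β]
    (hadd : (univ : Set ℝ).Definable L {v : Fin 3 → ℝ | v 0 + v 1 = v 2})
    (hmul : (univ : Set ℝ).Definable L {v : Fin 3 → ℝ | v 0 * v 1 = v 2})
    {Φ : (β → ℝ) → ℝ → ℝ}
    (hΦ : ∀ (γ : Type) [Finite γ] (q : (γ → ℝ) → β → ℝ) (t : (γ → ℝ) → ℝ),
      (univ : Set ℝ).DefinableMap L q → (univ : Set ℝ).DefinableFun L t →
        (univ : Set ℝ).DefinableFun L (fun u => Φ (q u) (t u)))
    {γ : Type} [Finite γ] {q : (γ → ℝ) → β → ℝ} {t a : (γ → ℝ) → ℝ}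
    (hq : (univ : Set ℝ).DefinableMap L q) (ht : (univ : Set ℝ).DefinableFun L t)
    (ha : (univ : Set ℝ).DefinableFun L a) :
    (univ : Set ℝ).Definable L {u : γ → ℝ | HasDerivAt (Φ (q u)) (a u) (t u)} := by
  -- the innermost variables: `u = w ∘ σ`, `c`, `δ`, `h`
  set σ : γ → ((γ ⊕ Unit) ⊕ Unit) ⊕ Unit := fun i => Sum.inl (Sum.inl (Sum.inl i)) with hσ
  have hU : (univ : Set ℝ).DefinableMap L
      (fun w : ((γ ⊕ Unit) ⊕ Unit) ⊕ Unit → ℝ => q (w ∘ σ)) :=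
    fun j => (hq j).comp (definableMap_comp_index σ)
  have htU : (univ : Set ℝ).DefinableFun L
      (fun w : ((γ ⊕ Unit) ⊕ Unit) ⊕ Unit → ℝ => t (w ∘ σ)) :=
    ht.comp (definableMap_comp_index σ)
  have haU : (univ : Set ℝ).DefinableFun L
      (fun w : ((γ ⊕ Unit) ⊕ Unit) ⊕ Unit → ℝ => a (w ∘ σ)) :=
    ha.comp (definableMap_comp_index σ)
  have hC : (univ : Set ℝ).DefinableFun L
      (fun w : ((γ ⊕ Unit) ⊕ Unit) ⊕ Unit → ℝ => w (Sum.inl (Sum.inl (Sum.inr ())))) :=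
    definableFun_proj _
  have hD : (univ : Set ℝ).DefinableFun L
      (fun w : ((γ ⊕ Unit) ⊕ Unit) ⊕ Unit → ℝ => w (Sum.inl (Sum.inr ()))) :=
    definableFun_proj _
  have hH : (univ : Set ℝ).DefinableFun L
      (fun w : ((γ ⊕ Unit) ⊕ Unit) ⊕ Unit → ℝ => w (Sum.inr ())) :=
    definableFun_proj _
  have hT1 : (univ : Set ℝ).DefinableFun L (fun w : ((γ ⊕ Unit) ⊕ Unit) ⊕ Unit → ℝ =>
      Φ (q (w ∘ σ)) (t (w ∘ σ) + w (Sum.inr ()))) :=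
    hΦ _ _ _ hU (definableFun_add hadd htU hH)
  have hT2 : (univ : Set ℝ).DefinableFun L (fun w : ((γ ⊕ Unit) ⊕ Unit) ⊕ Unit → ℝ =>
      Φ (q (w ∘ σ)) (t (w ∘ σ))) :=
    hΦ _ _ _ hU htU
  have hE : (univ : Set ℝ).DefinableFun L (fun w : ((γ ⊕ Unit) ⊕ Unit) ⊕ Unit → ℝ =>
      Φ (q (w ∘ σ)) (t (w ∘ σ) + w (Sum.inr ())) - Φ (q (w ∘ σ)) (t (w ∘ σ)) -
        w (Sum.inr ()) * a (w ∘ σ)) :=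
    definableFun_sub hadd (definableFun_sub hadd hT1 hT2) (definableFun_mul hmul hH haU)
  have hatom : (univ : Set ℝ).Definable L {w : ((γ ⊕ Unit) ⊕ Unit) ⊕ Unit → ℝ |
      -w (Sum.inl (Sum.inr ())) < w (Sum.inr ()) → w (Sum.inr ()) < w (Sum.inl (Sum.inr ())) →
      (Φ (q (w ∘ σ)) (t (w ∘ σ) + w (Sum.inr ())) - Φ (q (w ∘ σ)) (t (w ∘ σ)) -
        w (Sum.inr ()) * a (w ∘ σ)) *
      (Φ (q (w ∘ σ)) (t (w ∘ σ) + w (Sum.inr ())) - Φ (q (w ∘ σ)) (t (w ∘ σ)) -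
        w (Sum.inr ()) * a (w ∘ σ)) ≤
      w (Sum.inl (Sum.inl (Sum.inr ()))) * w (Sum.inl (Sum.inl (Sum.inr ()))) *
        (w (Sum.inr ()) * w (Sum.inr ()))} :=
    definable_setOf_imp (definable_setOf_lt (definable_lt_of_field hadd hmul)
      (definableFun_neg hadd hD) hH)
      (definable_setOf_imp (definable_setOf_lt (definable_lt_of_field hadd hmul) hH hD)
        (definable_setOf_le (definable_lt_of_field hadd hmul) (definableFun_mul hmul hE hE)
          (definableFun_mul hmul (definableFun_mul hmul hC hC) (definableFun_mul hmul hH hH))))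
  simp only [hasDerivAt_iff_forall_exists_sq]
  apply definable_setOf_forall
  apply definable_setOf_imp (definable_setOf_lt (definable_lt_of_field hadd hmul)
    (definableFun_const' _ (0 : ℝ)) (definableFun_proj _))
  apply definable_setOf_exists
  apply definable_setOf_and (definable_setOf_lt (definable_lt_of_field hadd hmul)
    (definableFun_const' _ (0 : ℝ)) (definableFun_proj _))
  apply definable_setOf_forall
  exact hatom

/-- **The set of points of differentiability of a definable family is definable.**
[cite: Dries1998, Ch. 7 (1.1)] -/
theorem definable_setOf_differentiableAt [Finite β]
    (hadd : (univ : Set ℝ).Definable L {v : Fin 3 → ℝ | v 0 + v 1 = v 2})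
    (hmul : (univ : Set ℝ).Definable L {v : Fin 3 → ℝ | v 0 * v 1 = v 2})
    {Φ : (β → ℝ) → ℝ → ℝ}
    (hΦ : ∀ (γ : Type) [Finite γ] (q : (γ → ℝ) → β → ℝ) (t : (γ → ℝ) → ℝ),
      (univ : Set ℝ).DefinableMap L q → (univ : Set ℝ).DefinableFun L t →
        (univ : Set ℝ).DefinableFun L (fun u => Φ (q u) (t u)))
    {γ : Type} [Finite γ] {q : (γ → ℝ) → β → ℝ} {t : (γ → ℝ) → ℝ}
    (hq : (univ : Set ℝ).DefinableMap L q) (ht : (univ : Set ℝ).DefinableFun L t) :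
    (univ : Set ℝ).Definable L {u : γ → ℝ | DifferentiableAt ℝ (Φ (q u)) (t u)} := by
  have heq : {u : γ → ℝ | DifferentiableAt ℝ (Φ (q u)) (t u)} =
      {u : γ → ℝ | ∃ a' : ℝ, HasDerivAt (Φ (q u)) a' (t u)} := by
    ext u
    exact ⟨fun h => ⟨_, h.hasDerivAt⟩, fun ⟨a', ha'⟩ => ha'.differentiableAt⟩
  rw [heq]
  apply definable_setOf_exists
  exact definable_setOf_hasDerivAt hadd hmul hΦ
    (fun j => (hq j).comp (definableMap_comp_index Sum.inl))
    (ht.comp (definableMap_comp_index Sum.inl)) (definableFun_proj _)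

/-- **The derivative of a definable family is a definable family**: `(v, x) ↦ (Φ v)'(x)`
(Mathlib's `deriv`, `= 0` where `Φ v` is not differentiable) again has the closure property
`hΦ` (van den Dries 1998, Ch. 7, (1.1)). [cite: Dries1998, Ch. 7 (1.1)] -/
theorem definableFamily_deriv [Finite β]
    (hadd : (univ : Set ℝ).Definable L {v : Fin 3 → ℝ | v 0 + v 1 = v 2})
    (hmul : (univ : Set ℝ).Definable L {v : Fin 3 → ℝ | v 0 * v 1 = v 2})
    {Φ : (β → ℝ) → ℝ → ℝ}
    (hΦ : ∀ (γ : Type) [Finite γ] (q : (γ → ℝ) → β → ℝ) (t : (γ → ℝ) → ℝ),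
      (univ : Set ℝ).DefinableMap L q → (univ : Set ℝ).DefinableFun L t →
        (univ : Set ℝ).DefinableFun L (fun u => Φ (q u) (t u))) :
    ∀ (γ : Type) [Finite γ] (q : (γ → ℝ) → β → ℝ) (t : (γ → ℝ) → ℝ),
      (univ : Set ℝ).DefinableMap L q → (univ : Set ℝ).DefinableFun L t →
        (univ : Set ℝ).DefinableFun L (fun u => deriv (Φ (q u)) (t u)) := by
  intro γ _ q t hq ht
  have h1 : (univ : Set ℝ).Definable L {w : Option γ → ℝ |
      HasDerivAt (Φ (q (w ∘ some))) (w none) (t (w ∘ some))} :=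
    definable_setOf_hasDerivAt hadd hmul hΦ
      (fun j => (hq j).comp (definableMap_comp_index some))
      (ht.comp (definableMap_comp_index some)) (definableFun_proj _)
  have h2 : (univ : Set ℝ).Definable L {w : Option γ → ℝ |
      DifferentiableAt ℝ (Φ (q (w ∘ some))) (t (w ∘ some))} :=
    definable_setOf_differentiableAt hadd hmul hΦ
      (fun j => (hq j).comp (definableMap_comp_index some))
      (ht.comp (definableMap_comp_index some))
  have h3 := definable_setOf_or h1 (definable_setOf_and (definable_setOf_not h2)
    (definable_setOf_eq' (definableFun_proj none) (definableFun_const' (Option γ) (0 : ℝ))))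
  unfold Set.DefinableFun
  convert h3 using 1
  ext w
  simp only [Function.tupleGraph, mem_setOf_eq]
  constructor
  · intro hw
    by_cases hd : DifferentiableAt ℝ (Φ (q (w ∘ some))) (t (w ∘ some))
    · exact Or.inl (hw ▸ hd.hasDerivAt)
    · exact Or.inr ⟨hd, by rw [← hw, deriv_zero_of_not_differentiableAt hd]⟩
  · rintro (hw | ⟨hd, hw⟩)
    · exact hw.deriv
    · rw [hw, deriv_zero_of_not_differentiableAt hd]

end Definability

/-! ### (2.5) over `ℝ`: finitely many points of non-differentiability -/

section Smoothness

open MeasureTheory Filter Topology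

variable {L : Language} [L.Structure ℝ] {β : Type}

/-- **van den Dries 1998, Ch. 7, (2.5), over the reals**: a function `ℝ → ℝ` belonging to a
definable family in an o-minimal expansion of the real field is differentiable at all but
finitely many points. Proof (ours, via Lebesgue instead of Dini derivatives): the set of bad
points is definable, hence a finite union of points and intervals; if infinite it contains an
interval, on a subinterval of which `f` is monotone (monotonicity theorem), hence differentiable
almost everywhere — contradiction. [cite: Dries1998, Ch. 7 (2.5)] -/
theorem finite_setOf_not_differentiableAt [Finite β] (hO : L.IsOMinimal ℝ)
    (hadd : (univ : Set ℝ).Definable L {v : Fin 3 → ℝ | v 0 + v 1 = v 2})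
    (hmul : (univ : Set ℝ).Definable L {v : Fin 3 → ℝ | v 0 * v 1 = v 2})
    {Φ : (β → ℝ) → ℝ → ℝ}
    (hΦ : ∀ (γ : Type) [Finite γ] (q : (γ → ℝ) → β → ℝ) (t : (γ → ℝ) → ℝ),
      (univ : Set ℝ).DefinableMap L q → (univ : Set ℝ).DefinableFun L t →
        (univ : Set ℝ).DefinableFun L (fun u => Φ (q u) (t u)))
    (v : β → ℝ) : {x : ℝ | ¬ DifferentiableAt ℝ (Φ v) x}.Finite := by
  by_contra hinf
  have hlt := definable_lt_of_field hadd hmul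
  have hgraph := definable_graph_of_family hΦ v
  have hDdef : (univ : Set ℝ).Definable₁ L {x : ℝ | ¬ DifferentiableAt ℝ (Φ v) x} := by
    unfold Set.Definable₁
    exact definable_setOf_not (definable_setOf_differentiableAt hadd hmul hΦ
      (fun i => definableFun_const' (Fin 1) (v i)) (definableFun_proj 0))
  obtain ⟨a, b, hab, hsub⟩ := (hO _ hDdef).exists_Ioo_subset_of_infinite hinf
  obtain ⟨F, hF⟩ := monotonicity_continuousOn hO hlt hgraph
  obtain ⟨x, hxab, hxF⟩ := ((Ioo_infinite hab).sdiff F.finite_toSet).nonempty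
  obtain ⟨a', b', ha', hb', havoid⟩ := exists_Ioo_forall_notMem_of_notMem F hxF
  set a'' := max a a' with ha''
  set b'' := min b b' with hb''
  have hx'' : x ∈ Ioo a'' b'' := ⟨max_lt hxab.1 ha', lt_min hxab.2 hb'⟩
  have hlt'' : a'' < b'' := hx''.1.trans hx''.2
  have hsub1 : Ioo a'' b'' ⊆ Ioo a b := Ioo_subset_Ioo (le_max_left _ _) (min_le_left _ _)
  have hsub2 : Ioo a'' b'' ⊆ Ioo a' b' := Ioo_subset_Ioo (le_max_right _ _) (min_le_right _ _)
  have hbad : ∀ y ∈ Ioo a'' b'', ¬ DifferentiableAt ℝ (Φ v) y := fun y hy => hsub (hsub1 hy)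
  -- on `(a'', b'')`, `Φ v` is differentiable almost everywhere
  have key : ∀ᵐ y, y ∈ Ioo a'' b'' → DifferentiableAt ℝ (Φ v) y := by
    have hup : ∀ {g : ℝ → ℝ}, MonotoneOn g (Ioo a'' b'') →
        ∀ᵐ y, y ∈ Ioo a'' b'' → DifferentiableAt ℝ g y := fun hg => by
      filter_upwards [hg.ae_differentiableWithinAt_of_mem] with y hy hy'
      exact (hy hy').differentiableAt (Ioo_mem_nhds hy'.1 hy'.2)
    rcases hF a'' b'' (fun z hz hz' => havoid z hz (hsub2 hz')) with hconst | ⟨hmono | hanti, -⟩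
    · refine Filter.Eventually.of_forall fun y hy => ?_
      have hev : Φ v =ᶠ[𝓝 y] fun _ => Φ v y :=
        Filter.eventually_of_mem (Ioo_mem_nhds hy.1 hy.2) fun z hz => hconst z hz y hy
      exact (differentiableAt_const _).congr_of_eventuallyEq hev
    · exact hup hmono.monotoneOn
    · filter_upwards [hup hanti.antitoneOn.neg] with y hy hy'
      simpa using (hy hy').neg
  have hzero : volume (Ioo a'' b'') = 0 := by
    rw [measure_eq_zero_iff_ae_notMem]
    filter_upwards [key] with y hy hy'
    exact hbad y hy' (hy hy')
  rw [Real.volume_Ioo, ENNReal.ofReal_eq_zero] at hzero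
  linarith

/-- **Definable functions are piecewise `C^k`** (van den Dries 1998, Ch. 7, (2.5) iterated, as
in the proof of (3.2) `(II_1)`), over the reals: for every member `Φ v` of a definable family
in an o-minimal expansion of the real field and every `k`, there is a finite set `F ⊆ ℝ` such
that `Φ v` is `C^k` on every open interval containing no point of `F`.
[cite: Dries1998, Ch. 7 (2.5) and (3.2)] -/
theorem exists_finset_contDiffOn [Finite β] (hO : L.IsOMinimal ℝ)
    (hadd : (univ : Set ℝ).Definable L {v : Fin 3 → ℝ | v 0 + v 1 = v 2})
    (hmul : (univ : Set ℝ).Definable L {v : Fin 3 → ℝ | v 0 * v 1 = v 2}) (k : ℕ) :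
    ∀ {Φ : (β → ℝ) → ℝ → ℝ},
      (∀ (γ : Type) [Finite γ] (q : (γ → ℝ) → β → ℝ) (t : (γ → ℝ) → ℝ),
        (univ : Set ℝ).DefinableMap L q → (univ : Set ℝ).DefinableFun L t →
          (univ : Set ℝ).DefinableFun L (fun u => Φ (q u) (t u))) →
      ∀ v : β → ℝ, ∃ F : Finset ℝ, ∀ a b : ℝ, (∀ z ∈ F, z ∉ Ioo a b) →
        ContDiffOn ℝ k (Φ v) (Ioo a b) := by
  induction k with
  | zero =>
    intro Φ hΦ v
    obtain ⟨F, hF⟩ := monotonicity_continuousOn hO (definable_lt_of_field hadd hmul)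
      (definable_graph_of_family hΦ v)
    refine ⟨F, fun a b hab => ?_⟩
    rw [Nat.cast_zero, contDiffOn_zero]
    rcases hF a b hab with hconst | ⟨-, hcont⟩
    · rcases (Ioo a b).eq_empty_or_nonempty with h | ⟨y, hy⟩
      · rw [h]; exact continuousOn_empty _
      · exact continuousOn_const.congr fun z hz => hconst z hz y hy
    · exact hcont
  | succ k ih =>
    intro Φ hΦ v
    classical
    obtain ⟨F₂, hF₂⟩ := ih (Φ := fun v x => deriv (Φ v) x) (definableFamily_deriv hadd hmul hΦ) v
    set F₁ := (finite_setOf_not_differentiableAt hO hadd hmul hΦ v).toFinset with hF₁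
    refine ⟨F₁ ∪ F₂, fun a b hab => ?_⟩
    have h1 : ∀ z ∈ F₁, z ∉ Ioo a b := fun z hz => hab z (Finset.mem_union_left _ hz)
    have h2 : ∀ z ∈ F₂, z ∉ Ioo a b := fun z hz => hab z (Finset.mem_union_right _ hz)
    have hdiff : DifferentiableOn ℝ (Φ v) (Ioo a b) := fun y hy => by
      have hy' : DifferentiableAt ℝ (Φ v) y := by
        by_contra hnd
        exact h1 y (by simpa [hF₁] using hnd) hy
      exact hy'.differentiableWithinAt
    rw [Nat.cast_succ, contDiffOn_succ_iff_deriv_of_isOpen isOpen_Ioo]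
    exact ⟨hdiff, fun h => absurd h (WithTop.natCast_ne_top k), hF₂ a b h2⟩

end Smoothness


/-! ### The `C^k` locus of a definable family and its uniformly finite complement -/

section CkLocus

open Topology

variable {L : Language} [L.Structure ℝ] {β : Type}

/-- `C^k` on an open interval in terms of iterates of `deriv`: `f` is `C^k` on `(a, b)` iff
`deriv^[j] f` is differentiable there for `j < k` and `deriv^[k] f` is continuous there
(Mathlib's `contDiffOn_succ_iff_deriv_of_isOpen`, iterated). [folklore] -/
theorem contDiffOn_Ioo_iff_iterate_deriv (k : ℕ) : ∀ {f : ℝ → ℝ} {a b : ℝ},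
    ContDiffOn ℝ k f (Ioo a b) ↔
      (∀ j < k, ∀ y ∈ Ioo a b, DifferentiableAt ℝ (deriv^[j] f) y) ∧
        ∀ y ∈ Ioo a b, ContinuousAt (deriv^[k] f) y := by
  induction k with
  | zero =>
    intro f a b
    rw [Nat.cast_zero, contDiffOn_zero, isOpen_Ioo.continuousOn_iff]
    simp
  | succ k ih =>
    intro f a b
    rw [Nat.cast_succ, contDiffOn_succ_iff_deriv_of_isOpen isOpen_Ioo, ih]
    constructor
    · rintro ⟨hd, -, hj, hc⟩
      refine ⟨fun j hj' y hy => ?_, fun y hy => ?_⟩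
      · rcases j with _ | j
        · exact (hd y hy).differentiableAt (isOpen_Ioo.mem_nhds hy)
        · rw [Function.iterate_succ_apply]
          exact hj j (by omega) y hy
      · rw [Function.iterate_succ_apply]
        exact hc y hy
    · rintro ⟨hj, hc⟩
      refine ⟨fun y hy => (hj 0 (by omega) y hy).differentiableWithinAt,
        fun h => absurd h (WithTop.natCast_ne_top k), fun j hj' y hy => ?_, fun y hy => ?_⟩
      · have := hj (j + 1) (by omega) y hy
        rwa [Function.iterate_succ_apply] at this
      · have := hc y hy
        rwa [Function.iterate_succ_apply] at this

/-- **Iterated derivatives of a definable family form a definable family.**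
[cite: Dries1998, Ch. 7 (1.1)] -/
theorem definableFamily_iterate_deriv [Finite β]
    (hadd : (univ : Set ℝ).Definable L {v : Fin 3 → ℝ | v 0 + v 1 = v 2})
    (hmul : (univ : Set ℝ).Definable L {v : Fin 3 → ℝ | v 0 * v 1 = v 2}) (j : ℕ) :
    ∀ {Φ : (β → ℝ) → ℝ → ℝ},
      (∀ (γ : Type) [Finite γ] (q : (γ → ℝ) → β → ℝ) (t : (γ → ℝ) → ℝ),
        (univ : Set ℝ).DefinableMap L q → (univ : Set ℝ).DefinableFun L t →
          (univ : Set ℝ).DefinableFun L (fun u => Φ (q u) (t u))) →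
      ∀ (γ : Type) [Finite γ] (q : (γ → ℝ) → β → ℝ) (t : (γ → ℝ) → ℝ),
        (univ : Set ℝ).DefinableMap L q → (univ : Set ℝ).DefinableFun L t →
          (univ : Set ℝ).DefinableFun L (fun u => deriv^[j] (Φ (q u)) (t u)) := by
  induction j with
  | zero => intro Φ hΦ; simpa using hΦ
  | succ j ih =>
    intro Φ hΦ γ _ q t hq ht
    have h := ih (Φ := fun v x => deriv (Φ v) x) (definableFamily_deriv hadd hmul hΦ) γ q t hq ht
    simpa only [Function.iterate_succ_apply] using h

/-- **Continuity at a point is definable** for definable families (`ε`–`δ`).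
[folklore] -/
theorem definable_setOf_continuousAt [Finite β]
    (hadd : (univ : Set ℝ).Definable L {v : Fin 3 → ℝ | v 0 + v 1 = v 2})
    (hmul : (univ : Set ℝ).Definable L {v : Fin 3 → ℝ | v 0 * v 1 = v 2})
    {Φ : (β → ℝ) → ℝ → ℝ}
    (hΦ : ∀ (γ : Type) [Finite γ] (q : (γ → ℝ) → β → ℝ) (t : (γ → ℝ) → ℝ),
      (univ : Set ℝ).DefinableMap L q → (univ : Set ℝ).DefinableFun L t →
        (univ : Set ℝ).DefinableFun L (fun u => Φ (q u) (t u)))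
    {γ : Type} [Finite γ] {q : (γ → ℝ) → β → ℝ} {t : (γ → ℝ) → ℝ}
    (hq : (univ : Set ℝ).DefinableMap L q) (ht : (univ : Set ℝ).DefinableFun L t) :
    (univ : Set ℝ).Definable L {u : γ → ℝ | ContinuousAt (Φ (q u)) (t u)} := by
  have heq : {u : γ → ℝ | ContinuousAt (Φ (q u)) (t u)} = {u : γ → ℝ | ∀ ε : ℝ, 0 < ε →
      ∃ δ : ℝ, 0 < δ ∧ ∀ y : ℝ, y - t u < δ → t u - y < δ →
        Φ (q u) y - Φ (q u) (t u) < ε ∧ Φ (q u) (t u) - Φ (q u) y < ε} := by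
    ext u
    simp only [mem_setOf_eq, Metric.continuousAt_iff, Real.dist_eq, abs_sub_lt_iff]
    constructor
    · intro h ε hε
      obtain ⟨δ, hδ, hh⟩ := h ε hε
      exact ⟨δ, hδ, fun y h1 h2 => hh ⟨h1, h2⟩⟩
    · intro h ε hε
      obtain ⟨δ, hδ, hh⟩ := h ε hε
      exact ⟨δ, hδ, fun y h12 => hh y h12.1 h12.2⟩
  rw [heq]
  set σ : γ → ((γ ⊕ Unit) ⊕ Unit) ⊕ Unit := fun i => Sum.inl (Sum.inl (Sum.inl i)) with hσ
  have hU : (univ : Set ℝ).DefinableMap L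
      (fun w : ((γ ⊕ Unit) ⊕ Unit) ⊕ Unit → ℝ => q (w ∘ σ)) :=
    fun j => (hq j).comp (definableMap_comp_index σ)
  have htU : (univ : Set ℝ).DefinableFun L
      (fun w : ((γ ⊕ Unit) ⊕ Unit) ⊕ Unit → ℝ => t (w ∘ σ)) :=
    ht.comp (definableMap_comp_index σ)
  have hE : (univ : Set ℝ).DefinableFun L
      (fun w : ((γ ⊕ Unit) ⊕ Unit) ⊕ Unit → ℝ => w (Sum.inl (Sum.inl (Sum.inr ())))) :=
    definableFun_proj _
  have hD : (univ : Set ℝ).DefinableFun L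
      (fun w : ((γ ⊕ Unit) ⊕ Unit) ⊕ Unit → ℝ => w (Sum.inl (Sum.inr ()))) :=
    definableFun_proj _
  have hY : (univ : Set ℝ).DefinableFun L
      (fun w : ((γ ⊕ Unit) ⊕ Unit) ⊕ Unit → ℝ => w (Sum.inr ())) :=
    definableFun_proj _
  have hΦY : (univ : Set ℝ).DefinableFun L (fun w : ((γ ⊕ Unit) ⊕ Unit) ⊕ Unit → ℝ =>
      Φ (q (w ∘ σ)) (w (Sum.inr ()))) := hΦ _ _ _ hU hY
  have hΦT : (univ : Set ℝ).DefinableFun L (fun w : ((γ ⊕ Unit) ⊕ Unit) ⊕ Unit → ℝ =>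
      Φ (q (w ∘ σ)) (t (w ∘ σ))) := hΦ _ _ _ hU htU
  have hlt := definable_lt_of_field hadd hmul
  apply definable_setOf_forall
  apply definable_setOf_imp (definable_setOf_lt hlt (definableFun_const' _ (0 : ℝ))
    (definableFun_proj _))
  apply definable_setOf_exists
  apply definable_setOf_and (definable_setOf_lt hlt (definableFun_const' _ (0 : ℝ))
    (definableFun_proj _))
  apply definable_setOf_forall
  exact definable_setOf_imp (definable_setOf_lt hlt (definableFun_sub hadd hY htU) hD)
    (definable_setOf_imp (definable_setOf_lt hlt (definableFun_sub hadd htU hY) hD)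
      (definable_setOf_and (definable_setOf_lt hlt (definableFun_sub hadd hΦY hΦT) hE)
        (definable_setOf_lt hlt (definableFun_sub hadd hΦT hΦY) hE)))

/-- **The `C^k` locus of a definable family is definable**: the set of `u` such that `Φ (q u)`
is `C^k` on some open interval around `t u` (written with iterates of `deriv`, cf.
`contDiffOn_Ioo_iff_iterate_deriv`). [cite: Dries1998, Ch. 7 (1.1)] -/
theorem definable_setOf_locallyContDiff [Finite β]
    (hadd : (univ : Set ℝ).Definable L {v : Fin 3 → ℝ | v 0 + v 1 = v 2})
    (hmul : (univ : Set ℝ).Definable L {v : Fin 3 → ℝ | v 0 * v 1 = v 2})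
    {Φ : (β → ℝ) → ℝ → ℝ}
    (hΦ : ∀ (γ : Type) [Finite γ] (q : (γ → ℝ) → β → ℝ) (t : (γ → ℝ) → ℝ),
      (univ : Set ℝ).DefinableMap L q → (univ : Set ℝ).DefinableFun L t →
        (univ : Set ℝ).DefinableFun L (fun u => Φ (q u) (t u)))
    (k : ℕ) {γ : Type} [Finite γ] {q : (γ → ℝ) → β → ℝ} {t : (γ → ℝ) → ℝ}
    (hq : (univ : Set ℝ).DefinableMap L q) (ht : (univ : Set ℝ).DefinableFun L t) :
    (univ : Set ℝ).Definable L {u : γ → ℝ | ∃ a b : ℝ, a < t u ∧ t u < b ∧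
      (∀ j < k, ∀ y : ℝ, a < y → y < b → DifferentiableAt ℝ (deriv^[j] (Φ (q u))) y) ∧
      (∀ y : ℝ, a < y → y < b → ContinuousAt (deriv^[k] (Φ (q u))) y)} := by
  classical
  have hlt := definable_lt_of_field hadd hmul
  -- variables after `∃ a ∃ b`: `u = w ∘ σ₂`, `a`, `b`; after `∀ y`: one more
  set σ₂ : γ → (γ ⊕ Unit) ⊕ Unit := fun i => Sum.inl (Sum.inl i) with hσ₂
  set σ₃ : γ → ((γ ⊕ Unit) ⊕ Unit) ⊕ Unit := fun i => Sum.inl (Sum.inl (Sum.inl i)) with hσ₃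
  -- the two inner blocks, as definable sets of `w : (γ ⊕ Unit) ⊕ Unit → ℝ`
  have hblockD : ∀ j : ℕ, (univ : Set ℝ).Definable L {w : (γ ⊕ Unit) ⊕ Unit → ℝ |
      ∀ y : ℝ, w (Sum.inl (Sum.inr ())) < y → y < w (Sum.inr ()) →
        DifferentiableAt ℝ (deriv^[j] (Φ (q (w ∘ σ₂)))) y} := by
    intro j
    apply definable_setOf_forall
    refine definable_setOf_imp (definable_setOf_lt hlt (definableFun_proj _) (definableFun_proj _))
      (definable_setOf_imp (definable_setOf_lt hlt (definableFun_proj _) (definableFun_proj _)) ?_)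
    exact definable_setOf_differentiableAt hadd hmul (Φ := fun v x => deriv^[j] (Φ v) x)
      (definableFamily_iterate_deriv hadd hmul j hΦ)
      (fun i => (hq i).comp (definableMap_comp_index σ₃)) (definableFun_proj _)
  have hblockC : (univ : Set ℝ).Definable L {w : (γ ⊕ Unit) ⊕ Unit → ℝ |
      ∀ y : ℝ, w (Sum.inl (Sum.inr ())) < y → y < w (Sum.inr ()) →
        ContinuousAt (deriv^[k] (Φ (q (w ∘ σ₂)))) y} := by
    apply definable_setOf_forall
    refine definable_setOf_imp (definable_setOf_lt hlt (definableFun_proj _) (definableFun_proj _))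
      (definable_setOf_imp (definable_setOf_lt hlt (definableFun_proj _) (definableFun_proj _)) ?_)
    exact definable_setOf_continuousAt hadd hmul (Φ := fun v x => deriv^[k] (Φ v) x)
      (definableFamily_iterate_deriv hadd hmul k hΦ)
      (fun i => (hq i).comp (definableMap_comp_index σ₃)) (definableFun_proj _)
  have hconj : (univ : Set ℝ).Definable L {w : (γ ⊕ Unit) ⊕ Unit → ℝ |
      ∀ j < k, ∀ y : ℝ, w (Sum.inl (Sum.inr ())) < y → y < w (Sum.inr ()) →
        DifferentiableAt ℝ (deriv^[j] (Φ (q (w ∘ σ₂)))) y} := by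
    have h := Set.definable_biInter_finset (fun j => hblockD j) (Finset.range k)
    convert h using 1
    ext w
    simp only [mem_setOf_eq, mem_iInter, Finset.mem_range]
  apply definable_setOf_exists
  apply definable_setOf_exists
  refine definable_setOf_and (definable_setOf_lt hlt (definableFun_proj _)
    (ht.comp (definableMap_comp_index σ₂))) (definable_setOf_and (definable_setOf_lt hlt
      (ht.comp (definableMap_comp_index σ₂)) (definableFun_proj _)) (definable_setOf_and ?_ ?_))
  · exact hconj
  · exact hblockC

/-- **Off finitely many points each member of a definable family is locally `C^k`**: the
complement of the `C^k` locus of `Φ v` is finite (from `exists_finset_contDiffOn`).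
[cite: Dries1998, Ch. 7 (2.5) and (3.2)] -/
theorem finite_setOf_not_locallyContDiff [Finite β] (hO : L.IsOMinimal ℝ)
    (hadd : (univ : Set ℝ).Definable L {v : Fin 3 → ℝ | v 0 + v 1 = v 2})
    (hmul : (univ : Set ℝ).Definable L {v : Fin 3 → ℝ | v 0 * v 1 = v 2})
    {Φ : (β → ℝ) → ℝ → ℝ}
    (hΦ : ∀ (γ : Type) [Finite γ] (q : (γ → ℝ) → β → ℝ) (t : (γ → ℝ) → ℝ),
      (univ : Set ℝ).DefinableMap L q → (univ : Set ℝ).DefinableFun L t →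
        (univ : Set ℝ).DefinableFun L (fun u => Φ (q u) (t u)))
    (k : ℕ) (v : β → ℝ) :
    {x : ℝ | ¬ ∃ a b : ℝ, a < x ∧ x < b ∧
      (∀ j < k, ∀ y : ℝ, a < y → y < b → DifferentiableAt ℝ (deriv^[j] (Φ v)) y) ∧
      (∀ y : ℝ, a < y → y < b → ContinuousAt (deriv^[k] (Φ v)) y)}.Finite := by
  obtain ⟨F, hF⟩ := exists_finset_contDiffOn hO hadd hmul k hΦ v
  refine F.finite_toSet.subset fun x hx => ?_
  by_contra hxF
  apply hx
  obtain ⟨a, b, hax, hxb, havoid⟩ := exists_Ioo_forall_notMem_of_notMem F hxF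
  have hk := (contDiffOn_Ioo_iff_iterate_deriv k).mp (hF a b havoid)
  exact ⟨a, b, hax, hxb, fun j hj y hay hyb => hk.1 j hj y ⟨hay, hyb⟩,
    fun y hay hyb => hk.2 y ⟨hay, hyb⟩⟩

/-- Conversely, **on an open interval containing no point outside the `C^k` locus, `Φ v` is
`C^k`** (`C^k` is a local property). [folklore] -/
theorem contDiffOn_Ioo_of_forall_locallyContDiff {f : ℝ → ℝ} {k : ℕ} {c d : ℝ}
    (h : ∀ x ∈ Ioo c d, ∃ a b : ℝ, a < x ∧ x < b ∧
      (∀ j < k, ∀ y : ℝ, a < y → y < b → DifferentiableAt ℝ (deriv^[j] f) y) ∧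
      (∀ y : ℝ, a < y → y < b → ContinuousAt (deriv^[k] f) y)) :
    ContDiffOn ℝ k f (Ioo c d) := by
  apply contDiffOn_of_locally_contDiffOn
  intro x hx
  obtain ⟨a, b, hax, hxb, hd, hc⟩ := h x hx
  refine ⟨Ioo a b, isOpen_Ioo, ⟨hax, hxb⟩, ?_⟩
  rw [Ioo_inter_Ioo]
  apply (contDiffOn_Ioo_iff_iterate_deriv k).mpr
  exact ⟨fun j hj y hy => hd j hj y (le_sup_right.trans_lt hy.1) (hy.2.trans_le inf_le_right),
    fun y hy => hc y (le_sup_right.trans_lt hy.1) (hy.2.trans_le inf_le_right)⟩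

/-- **Uniform finiteness of the non-`C^k` points** (van den Dries 1998, Ch. 3, (2.13) applied
to the definable family of bad sets): for a definable family `Φ` over `ℝ^m` there is `N` such
that every `Φ v` is locally `C^k` at all but at most `N` points. [cite: Dries1998, Ch. 3 (2.13)] -/
theorem exists_ncard_not_locallyContDiff_le {m : ℕ} (hO : L.IsOMinimal ℝ)
    (hadd : (univ : Set ℝ).Definable L {v : Fin 3 → ℝ | v 0 + v 1 = v 2})
    (hmul : (univ : Set ℝ).Definable L {v : Fin 3 → ℝ | v 0 * v 1 = v 2})
    {Φ : (Fin m → ℝ) → ℝ → ℝ}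
    (hΦ : ∀ (γ : Type) [Finite γ] (q : (γ → ℝ) → Fin m → ℝ) (t : (γ → ℝ) → ℝ),
      (univ : Set ℝ).DefinableMap L q → (univ : Set ℝ).DefinableFun L t →
        (univ : Set ℝ).DefinableFun L (fun u => Φ (q u) (t u)))
    (k : ℕ) :
    ∃ N : ℕ, ∀ v : Fin m → ℝ, {x : ℝ | ¬ ∃ a b : ℝ, a < x ∧ x < b ∧
      (∀ j < k, ∀ y : ℝ, a < y → y < b → DifferentiableAt ℝ (deriv^[j] (Φ v)) y) ∧
      (∀ y : ℝ, a < y → y < b → ContinuousAt (deriv^[k] (Φ v)) y)}.ncard ≤ N := by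
  set S : Set (Fin (m + 1) → ℝ) := {w | ¬ ∃ a b : ℝ, a < w (Fin.last m) ∧ w (Fin.last m) < b ∧
      (∀ j < k, ∀ y : ℝ, a < y → y < b →
        DifferentiableAt ℝ (deriv^[j] (Φ (Fin.init w))) y) ∧
      (∀ y : ℝ, a < y → y < b → ContinuousAt (deriv^[k] (Φ (Fin.init w))) y)} with hSdef
  have hS : (univ : Set ℝ).Definable L S :=
    definable_setOf_not (definable_setOf_locallyContDiff hadd hmul hΦ k
      (fun i => definableFun_proj (Fin.castSucc i)) (definableFun_proj (Fin.last m)))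
  have hfib : ∀ v : Fin m → ℝ, {r | (Fin.snoc v r : Fin (m + 1) → ℝ) ∈ S} =
      {x : ℝ | ¬ ∃ a b : ℝ, a < x ∧ x < b ∧
        (∀ j < k, ∀ y : ℝ, a < y → y < b → DifferentiableAt ℝ (deriv^[j] (Φ v)) y) ∧
        (∀ y : ℝ, a < y → y < b → ContinuousAt (deriv^[k] (Φ v)) y)} := by
    intro v
    ext r
    simp only [hSdef, mem_setOf_eq, Fin.snoc_last, Fin.init_snoc]
  obtain ⟨N, hN⟩ := CellDecomposition.uniformFiniteness hO (definable_lt_of_field hadd hmul) S hS fun v => by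
    rw [hfib]
    exact finite_setOf_not_locallyContDiff hO hadd hmul hΦ k v
  exact ⟨N, fun v => (hfib v) ▸ hN v⟩

end CkLocus


/-! ### Pila–Wilkie 2006, Lemma 3.1: the `x ↦ x²` trick -/

section SqTrick

/-- Chain rule for `x ↦ f(x²)` inside `(0,1)` (which `x ↦ x²` maps into itself). [folklore] -/
theorem derivWithin_comp_sq {f : ℝ → ℝ} {n : WithTop ℕ∞} (hf : ContDiffOn ℝ n f (Ioo 0 1))
    (hn : n ≠ 0) :
    EqOn (derivWithin (fun x => f (x ^ 2)) (Ioo 0 1))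
      (fun x => 2 * x * derivWithin f (Ioo 0 1) (x ^ 2)) (Ioo 0 1) := by
  intro x hx
  have hx2 : x ^ 2 ∈ Ioo (0 : ℝ) 1 := ⟨by nlinarith [hx.1], by nlinarith [hx.1, hx.2]⟩
  have hmaps : MapsTo (fun x : ℝ => x ^ 2) (Ioo 0 1) (Ioo 0 1) := fun y hy =>
    ⟨by nlinarith [hy.1], by nlinarith [hy.1, hy.2]⟩
  have hfd : HasDerivWithinAt f (derivWithin f (Ioo 0 1) (x ^ 2)) (Ioo 0 1)
      ((fun y : ℝ => y ^ 2) x) :=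
    ((hf.differentiableOn hn) _ hx2).hasDerivWithinAt
  have hsq : HasDerivWithinAt (fun y : ℝ => y ^ 2) (2 * x) (Ioo 0 1) x := by
    simpa using (hasDerivAt_pow 2 x).hasDerivWithinAt
  have h := HasDerivWithinAt.comp x hfd hsq hmaps (h := fun y : ℝ => y ^ 2)
  rw [show (fun x => f (x ^ 2)) = f ∘ (fun y : ℝ => y ^ 2) from rfl,
    h.derivWithin (uniqueDiffOn_Ioo 0 1 x hx)]
  ring

/-- `x ↦ f(x²)` is as smooth as `f` on `(0,1)`. [folklore] -/
theorem contDiffOn_comp_sq {f : ℝ → ℝ} {n : WithTop ℕ∞} (hf : ContDiffOn ℝ n f (Ioo 0 1)) :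
    ContDiffOn ℝ n (fun x => f (x ^ 2)) (Ioo 0 1) :=
  hf.comp (contDiff_id.pow 2).contDiffOn fun y hy => ⟨by nlinarith [hy.1], by nlinarith [hy.1, hy.2]⟩

/-- Iterated derivatives of `y ↦ 2y` within `(0,1)`: `|D⁰| = 2x`, `|D¹| = 2`, `Dⁱ = 0` for
`i ≥ 2`. [folklore] -/
theorem abs_iteratedDerivWithin_two_mul {x : ℝ} (hx : x ∈ Ioo (0 : ℝ) 1) (i : ℕ) :
    |iteratedDerivWithin i (fun y : ℝ => 2 * y) (Ioo 0 1) x| =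
      if i = 0 then 2 * x else if i = 1 then 2 else 0 := by
  rw [iteratedDerivWithin_of_isOpen isOpen_Ioo hx]
  have h1 : deriv (fun y : ℝ => 2 * y) = fun _ => 2 := by
    funext y
    simp
  rcases i with _ | _ | i
  · rw [if_pos rfl, iteratedDeriv_zero, abs_of_pos (by linarith [hx.1])]
  · simp [h1]
  · rw [show i + 1 + 1 = (i + 1) + 1 from rfl, iteratedDeriv_succ', h1, iteratedDeriv_const]
    simp

/-- **Leibniz bound for multiplication by `2x`** within `(0,1)`: for `v` of class `C^m`,
`|D^m(2y · v)(x)| ≤ 2x |D^m v (x)| + 2m |D^{m-1} v(x)|`. [folklore] -/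
theorem abs_iteratedDerivWithin_two_mul_le {v : ℝ → ℝ} {m : ℕ} {N : WithTop ℕ∞}
    (hv : ContDiffOn ℝ N v (Ioo 0 1)) (hm : (m : WithTop ℕ∞) ≤ N) {x : ℝ}
    (hx : x ∈ Ioo (0 : ℝ) 1) :
    |iteratedDerivWithin m (fun y => 2 * y * v y) (Ioo 0 1) x| ≤
      2 * x * |iteratedDerivWithin m v (Ioo 0 1) x| +
        2 * m * |iteratedDerivWithin (m - 1) v (Ioo 0 1) x| := by
  have hs : UniqueDiffOn ℝ (Ioo (0 : ℝ) 1) := uniqueDiffOn_Ioo 0 1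
  have hlin : ContDiffOn ℝ N (fun y : ℝ => 2 * y) (Ioo 0 1) :=
    (contDiff_const.mul contDiff_id).contDiffOn
  have h := norm_iteratedFDerivWithin_mul_le hlin hv hs hx (n := m) hm
  simp only [norm_iteratedFDerivWithin_eq_norm_iteratedDerivWithin, Real.norm_eq_abs] at h
  refine h.trans ?_
  -- the general term, with the derivatives of `2y` evaluated
  set T : ℕ → ℝ := fun i => (m.choose i : ℝ) * |iteratedDerivWithin i (fun y : ℝ => 2 * y) (Ioo 0 1) x| *
    |iteratedDerivWithin (m - i) v (Ioo 0 1) x| with hT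
  have hz : ∀ i : ℕ, 2 ≤ i → T i = 0 := by
    intro i hi
    rw [hT]
    simp only []
    rw [abs_iteratedDerivWithin_two_mul hx i, if_neg (by omega), if_neg (by omega), mul_zero,
      zero_mul]
  have hT0 : T 0 = 2 * x * |iteratedDerivWithin m v (Ioo 0 1) x| := by
    rw [hT]
    simp only []
    rw [abs_iteratedDerivWithin_two_mul hx 0, if_pos rfl, Nat.choose_zero_right, Nat.cast_one,
      one_mul, Nat.sub_zero]
  have hT1 : 1 ≤ m → T 1 = 2 * m * |iteratedDerivWithin (m - 1) v (Ioo 0 1) x| := by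
    intro hm1
    rw [hT]
    simp only []
    rw [abs_iteratedDerivWithin_two_mul hx 1, if_neg one_ne_zero, if_pos rfl, Nat.choose_one_right]
    ring
  show ∑ i ∈ Finset.range (m + 1), T i ≤ _
  rcases m with _ | k
  · rw [Finset.sum_range_one, hT0]
    simp
  · -- split off the terms `i = 0, 1`; the rest vanishes
    have hsplit : ∑ i ∈ Finset.range (k + 1 + 1), T i = T 0 + T 1 + ∑ i ∈ Finset.range k, T (i + 2) := by
      rw [Finset.sum_range_succ', Finset.sum_range_succ']
      ring
    rw [hsplit, Finset.sum_eq_zero (fun i _ => hz (i + 2) (by omega)), add_zero, hT0,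
      hT1 (by omega)]

/-- **The inductive core of Lemma 3.1** (ours, replacing the printed Faà di Bruno bookkeeping
*"`g^{(i)}(x) = Σ_{j=0}^{i} ρ_{i,j}(x) f^{(j)}(x²)`"* by an induction on `r` through
`(f ∘ sq)' = 2x · (f' ∘ sq)` and the Leibniz bound): if `f` is `C^r` on `(0,1)` (`r ≥ 1`) with
`|f^{(j)}| ≤ c` for `j < r` and `|f^{(r)}(y)| ≤ K / y`, then `g(x) = f(x²)` has
`|g^{(i)}| ≤ 2^r r! (c + K)` for `i < r`, `|g^{(r)}(x)| ≤ 2^r r! (c + K) / x`, and, as soon as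
`r ≥ 2`, `|g^{(r)}| ≤ 2^r r! (c + K)` outright (Pila–Wilkie 2006, proof of Lemma 3.1: *"all
summands are strongly bounded except, possibly, the one with `i = j = r` … this summand is
`2^r x^r f^{(r)}(x²)`"*). [cite: PilaWilkie2006, Lemma 3.1 (proof)] -/
theorem sq_trick_aux (r : ℕ) (hr : 1 ≤ r) : ∀ (f : ℝ → ℝ) (c K : ℝ), 0 ≤ c → 0 ≤ K →
    ContDiffOn ℝ r f (Ioo 0 1) →
    (∀ j < r, ∀ y ∈ Ioo (0 : ℝ) 1, |iteratedDerivWithin j f (Ioo 0 1) y| ≤ c) →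
    (∀ y ∈ Ioo (0 : ℝ) 1, |iteratedDerivWithin r f (Ioo 0 1) y| ≤ K / y) →
    (∀ i < r, ∀ x ∈ Ioo (0 : ℝ) 1,
      |iteratedDerivWithin i (fun x => f (x ^ 2)) (Ioo 0 1) x| ≤ 2 ^ r * r.factorial * (c + K)) ∧
    (∀ x ∈ Ioo (0 : ℝ) 1,
      |iteratedDerivWithin r (fun x => f (x ^ 2)) (Ioo 0 1) x| ≤ 2 ^ r * r.factorial * (c + K) / x) ∧
    (2 ≤ r → ∀ x ∈ Ioo (0 : ℝ) 1,
      |iteratedDerivWithin r (fun x => f (x ^ 2)) (Ioo 0 1) x| ≤ 2 ^ r * r.factorial * (c + K)) := by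
  induction r, hr using Nat.le_induction with
  | base =>
    intro f c K hc hK hf hb htop
    have hsq2 : ∀ x ∈ Ioo (0 : ℝ) 1, x ^ 2 ∈ Ioo (0 : ℝ) 1 := fun x hx =>
      ⟨by nlinarith [hx.1], by nlinarith [hx.1, hx.2]⟩
    refine ⟨fun i hi x hx => ?_, fun x hx => ?_, fun h => absurd h (by norm_num)⟩
    · have hi0 : i = 0 := by omega
      subst hi0
      rw [iteratedDerivWithin_zero]
      have := hb 0 (by norm_num) (x ^ 2) (hsq2 x hx)
      rw [iteratedDerivWithin_zero] at this
      simp only [pow_one, Nat.factorial_one, Nat.cast_one, mul_one]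
      linarith
    · rw [iteratedDerivWithin_one, derivWithin_comp_sq hf (by norm_num) hx]
      have h1 := htop (x ^ 2) (hsq2 x hx)
      rw [iteratedDerivWithin_one] at h1
      have hx0 : 0 < x := hx.1
      rw [abs_mul, abs_of_pos (by linarith : (0 : ℝ) < 2 * x)]
      simp only [pow_one, Nat.factorial_one, Nat.cast_one, mul_one]
      rw [le_div_iff₀ hx0]
      have h2 : |derivWithin f (Ioo 0 1) (x ^ 2)| * x ^ 2 ≤ K := by
        have := (le_div_iff₀ (by positivity : (0 : ℝ) < x ^ 2)).mp h1
        linarith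
      nlinarith [abs_nonneg (derivWithin f (Ioo 0 1) (x ^ 2))]
  | succ r hr ih =>
    intro f c K hc hK hf hb htop
    have hs : UniqueDiffOn ℝ (Ioo (0 : ℝ) 1) := uniqueDiffOn_Ioo 0 1
    have hsq2 : ∀ x ∈ Ioo (0 : ℝ) 1, x ^ 2 ∈ Ioo (0 : ℝ) 1 := fun x hx =>
      ⟨by nlinarith [hx.1], by nlinarith [hx.1, hx.2]⟩
    -- `u = f'` is `C^r` with the shifted bounds
    set u : ℝ → ℝ := derivWithin f (Ioo 0 1) with hu
    have huc : ContDiffOn ℝ r u (Ioo 0 1) := by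
      have h := hf.derivWithin hs (m := r) (by push_cast; exact le_rfl)
      exact h
    have hushift : ∀ j, iteratedDerivWithin j u (Ioo 0 1) = iteratedDerivWithin (j + 1) f (Ioo 0 1) :=
      fun j => (iteratedDerivWithin_succ' (n := j) (f := f) (s := Ioo 0 1)).symm
    have hub : ∀ j < r, ∀ y ∈ Ioo (0 : ℝ) 1, |iteratedDerivWithin j u (Ioo 0 1) y| ≤ c :=
      fun j hj y hy => by rw [hushift]; exact hb (j + 1) (by omega) y hy
    have hutop : ∀ y ∈ Ioo (0 : ℝ) 1, |iteratedDerivWithin r u (Ioo 0 1) y| ≤ K / y :=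
      fun y hy => by rw [hushift]; exact htop y hy
    obtain ⟨hv1, hv2, -⟩ := ih u c K hc hK huc hub hutop
    -- `v = u ∘ sq`, `g' = 2x · v`
    set v : ℝ → ℝ := fun x => u (x ^ 2) with hvdef
    have hvc : ContDiffOn ℝ r v (Ioo 0 1) := contDiffOn_comp_sq huc
    have hg' : EqOn (derivWithin (fun x => f (x ^ 2)) (Ioo 0 1)) (fun x => 2 * x * v x) (Ioo 0 1) :=
      derivWithin_comp_sq hf (by norm_cast)
    have hgi : ∀ i, ∀ x ∈ Ioo (0 : ℝ) 1, iteratedDerivWithin (i + 1) (fun x => f (x ^ 2)) (Ioo 0 1) x =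
        iteratedDerivWithin i (fun x => 2 * x * v x) (Ioo 0 1) x := by
      intro i x hx
      rw [iteratedDerivWithin_succ']
      exact iteratedDerivWithin_congr hg' hx
    -- the constants
    set B : ℝ := 2 ^ r * r.factorial * (c + K) with hB
    have hB0 : 0 ≤ B := by positivity
    have hBsucc : (2 : ℝ) ^ (r + 1) * (r + 1).factorial * (c + K) = (2 * r + 2) * B := by
      rw [hB, pow_succ, Nat.factorial_succ]
      push_cast
      ring
    have hcB : c ≤ (2 * r + 2) * B := by
      have h1 : (1 : ℝ) ≤ 2 ^ r * r.factorial := by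
        have : (1 : ℝ) ≤ 2 ^ r := one_le_pow₀ (by norm_num)
        have : (1 : ℝ) ≤ r.factorial := by exact_mod_cast Nat.factorial_pos r
        nlinarith
      have h2 : c ≤ B := by
        rw [hB]
        nlinarith
      have hr0 : (0 : ℝ) ≤ r := by positivity
      nlinarith
    -- the Leibniz estimate for `D^m (2x · v)`, `m ≤ r`
    have hleib : ∀ m : ℕ, m ≤ r → ∀ x ∈ Ioo (0 : ℝ) 1,
        |iteratedDerivWithin m (fun y => 2 * y * v y) (Ioo 0 1) x| ≤
          2 * x * |iteratedDerivWithin m v (Ioo 0 1) x| +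
            2 * m * |iteratedDerivWithin (m - 1) v (Ioo 0 1) x| :=
      fun m hm x hx => abs_iteratedDerivWithin_two_mul_le hvc (by exact_mod_cast hm) hx
    refine ⟨fun i hi x hx => ?_, fun x hx => ?_, fun _ x hx => ?_⟩
    · -- orders `i < r + 1`
      rw [hBsucc]
      rcases i with _ | i
      · rw [iteratedDerivWithin_zero]
        have := hb 0 (by omega) (x ^ 2) (hsq2 x hx)
        rw [iteratedDerivWithin_zero] at this
        linarith
      · rw [hgi i x hx]
        have hi' : i < r := by omega
        refine (hleib i hi'.le x hx).trans ?_
        have h1 : |iteratedDerivWithin i v (Ioo 0 1) x| ≤ B := hv1 i hi' x hx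
        have h2 : |iteratedDerivWithin (i - 1) v (Ioo 0 1) x| ≤ B := hv1 (i - 1) (by omega) x hx
        have hx1 : x ≤ 1 := hx.2.le
        have hx0 : 0 ≤ x := hx.1.le
        have hir : (i : ℝ) ≤ r := by exact_mod_cast hi'.le
        have hi0 : (0 : ℝ) ≤ i := by positivity
        nlinarith [abs_nonneg (iteratedDerivWithin i v (Ioo 0 1) x),
          abs_nonneg (iteratedDerivWithin (i - 1) v (Ioo 0 1) x)]
    · -- top order `r + 1`, with the weight `1/x`
      rw [hBsucc, hgi r x hx]
      have h1 : |iteratedDerivWithin r v (Ioo 0 1) x| ≤ B / x := hv2 x hx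
      have h2 : |iteratedDerivWithin (r - 1) v (Ioo 0 1) x| ≤ B := hv1 (r - 1) (by omega) x hx
      have hx0 : 0 < x := hx.1
      have hx1 : x ≤ 1 := hx.2.le
      have hr0 : (0 : ℝ) ≤ r := by positivity
      rw [le_div_iff₀ hx0] at h1
      rw [le_div_iff₀ hx0]
      calc |iteratedDerivWithin r (fun y => 2 * y * v y) (Ioo 0 1) x| * x
          ≤ (2 * x * |iteratedDerivWithin r v (Ioo 0 1) x| +
              2 * r * |iteratedDerivWithin (r - 1) v (Ioo 0 1) x|) * x :=
            mul_le_mul_of_nonneg_right (hleib r le_rfl x hx) hx0.le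
        _ = 2 * x * (|iteratedDerivWithin r v (Ioo 0 1) x| * x) +
              2 * r * x * |iteratedDerivWithin (r - 1) v (Ioo 0 1) x| := by ring
        _ ≤ 2 * x * B + 2 * r * x * B := by gcongr
        _ ≤ 2 * 1 * B + 2 * r * 1 * B := by gcongr
        _ = (2 * r + 2) * B := by ring
    · -- top order, bounded outright
      rw [hBsucc, hgi r x hx]
      refine (hleib r le_rfl x hx).trans ?_
      have h1 : |iteratedDerivWithin r v (Ioo 0 1) x| ≤ B / x := hv2 x hx
      have h2 : |iteratedDerivWithin (r - 1) v (Ioo 0 1) x| ≤ B := hv1 (r - 1) (by omega) x hx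
      have hx0 : 0 < x := hx.1
      have h1' : 2 * x * |iteratedDerivWithin r v (Ioo 0 1) x| ≤ 2 * B := by
        rw [le_div_iff₀ hx0] at h1
        nlinarith
      have hr0 : (0 : ℝ) ≤ r := by positivity
      nlinarith [abs_nonneg (iteratedDerivWithin (r - 1) v (Ioo 0 1) x)]

/-- **The mean value step of Lemma 3.1** (Pila–Wilkie 2006, proof of Lemma 3.1: *"Let `c` be
a positive integer strongly bounding the function `f^{(r-1)}` and suppose, for a contradiction,
that there is some `x₀ ∈ (0,1)` with `|f^{(r)}(x₀)| > 4c/x₀`. By the Mean Value Theorem …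
`2c ≥ |f^{(r-1)}(x₀) − f^{(r-1)}(x₀/2)| > (4c/x₀)(x₀ − x₀/2) = 2c`"*): if `f` is `C^r` on
`(0,1)`, `|f^{(r-1)}| ≤ c` and `|f^{(r)}|` is weakly decreasing, then `|f^{(r)}(y)| ≤ 4c/y`.
[cite: PilaWilkie2006, Lemma 3.1 (proof)] -/
theorem abs_iteratedDerivWithin_le_div_of_antitoneOn {f : ℝ → ℝ} {r : ℕ} (hr : 1 ≤ r) {c : ℝ}
    (hf : ContDiffOn ℝ r f (Ioo 0 1))
    (hb : ∀ y ∈ Ioo (0 : ℝ) 1, |iteratedDerivWithin (r - 1) f (Ioo 0 1) y| ≤ c)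
    (hmono : AntitoneOn (fun y => |iteratedDerivWithin r f (Ioo 0 1) y|) (Ioo 0 1)) :
    ∀ y ∈ Ioo (0 : ℝ) 1, |iteratedDerivWithin r f (Ioo 0 1) y| ≤ 4 * c / y := by
  intro y hy
  have hs : UniqueDiffOn ℝ (Ioo (0 : ℝ) 1) := uniqueDiffOn_Ioo 0 1
  have hy0 : 0 < y := hy.1
  by_contra hlt
  push Not at hlt
  set F : ℝ → ℝ := iteratedDerivWithin (r - 1) f (Ioo 0 1) with hF
  have hr1 : r - 1 + 1 = r := by omega
  have hFd : DifferentiableOn ℝ F (Ioo 0 1) :=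
    hf.differentiableOn_iteratedDerivWithin (by exact_mod_cast (by omega : r - 1 < r)) hs
  have hFderiv : ∀ z ∈ Ioo (0 : ℝ) 1, deriv F z = iteratedDerivWithin r f (Ioo 0 1) z := by
    intro z hz
    rw [← derivWithin_of_isOpen isOpen_Ioo hz, hF, ← iteratedDerivWithin_succ, hr1]
  have hsub : Icc (y / 2) y ⊆ Ioo (0 : ℝ) 1 := fun z hz => ⟨by linarith [hz.1], by linarith [hz.2, hy.2]⟩
  have hFc : ContinuousOn F (Icc (y / 2) y) := (hFd.mono hsub).continuousOn
  have hFd' : DifferentiableOn ℝ F (Ioo (y / 2) y) := fun z hz =>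
    ((hFd z (hsub (Ioo_subset_Icc_self hz))).differentiableAt
      (isOpen_Ioo.mem_nhds (hsub (Ioo_subset_Icc_self hz)))).differentiableWithinAt
  obtain ⟨ξ, hξ, hξeq⟩ := exists_deriv_eq_slope F (by linarith : y / 2 < y) hFc hFd'
  have hξI : ξ ∈ Ioo (0 : ℝ) 1 := hsub (Ioo_subset_Icc_self hξ)
  -- `|F'(ξ)| ≥ |f^{(r)}(y)| > 4c/y`
  have h1 : 4 * c / y < |deriv F ξ| := by
    rw [hFderiv ξ hξI]
    exact hlt.trans_le (hmono hξI hy hξ.2.le)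
  -- `|F(y) − F(y/2)| ≤ 2c`
  have h2 : |deriv F ξ| ≤ 2 * c / (y / 2) := by
    rw [hξeq, abs_div, abs_of_pos (by linarith : (0 : ℝ) < y - y / 2), show y - y / 2 = y / 2 by ring]
    apply div_le_div_of_nonneg_right _ (by linarith)
    have ha := hb y hy
    have hb' := hb (y / 2) (hsub (left_mem_Icc.mpr (by linarith)))
    calc |F y - F (y / 2)| ≤ |F y| + |F (y / 2)| := abs_sub _ _
      _ ≤ c + c := add_le_add ha hb'
      _ = 2 * c := by ring
  have h3 : 2 * c / (y / 2) = 4 * c / y := by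
    field_simp
    ring
  linarith

/-- **Pila–Wilkie 2006, Lemma 3.1** over `ℝ` (with explicit constants). Printed: *"Let `r ≥ 2`
and suppose that `f : (0,1) → M` is a definable function of class `C^{(r)}` with `f^{(j)}`
strongly bounded for `0 ≤ j ≤ r − 1`. Suppose further that `|f^{(r)}|` is (weakly) decreasing.
Define `g : (0,1) → M` by `g(x) = f(x²)`. Then `g^{(j)}` is strongly bounded for
`0 ≤ j ≤ r`."* Here over the reals, definability being irrelevant for this analytic statement:
if `f` is `C^r` on `(0,1)`, `|f^{(j)}| ≤ c` on `(0,1)` for `j < r`, and `|f^{(r)}|` is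
antitone on `(0,1)`, then `|g^{(i)}| ≤ 2^r r! · 5c` on `(0,1)` for all `i ≤ r` (derivatives
within `(0,1)`). [cite: PilaWilkie2006, Lemma 3.1] -/
theorem PilaWilkie2006_lemma_3_1 {f : ℝ → ℝ} {r : ℕ} (hr : 2 ≤ r) {c : ℝ} (hc : 0 ≤ c)
    (hf : ContDiffOn ℝ r f (Ioo 0 1))
    (hb : ∀ j < r, ∀ y ∈ Ioo (0 : ℝ) 1, |iteratedDerivWithin j f (Ioo 0 1) y| ≤ c)
    (hmono : AntitoneOn (fun y => |iteratedDerivWithin r f (Ioo 0 1) y|) (Ioo 0 1)) :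
    ∀ i ≤ r, ∀ x ∈ Ioo (0 : ℝ) 1,
      |iteratedDerivWithin i (fun x => f (x ^ 2)) (Ioo 0 1) x| ≤ 2 ^ r * r.factorial * (5 * c) := by
  have hK := abs_iteratedDerivWithin_le_div_of_antitoneOn (by omega : 1 ≤ r) hf
    (hb (r - 1) (by omega)) hmono
  obtain ⟨h1, -, h3⟩ := sq_trick_aux r (by omega) f c (4 * c) hc (by positivity) hf hb hK
  intro i hi x hx
  have h5 : c + 4 * c = 5 * c := by ring
  rcases hi.lt_or_eq with hi | rfl
  · simpa only [h5] using h1 i hi x hx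
  · simpa only [h5] using h3 hr x hx

end SqTrick

/-! ### Affine reparametrizations `x ↦ p + q x` -/

section Affine

/-- **Derivatives of an affine reparametrization**: for `θ(x) = p + q x` mapping `(0,1)` into an
open set `J` on which `f` is `C^k`, `(f ∘ θ)^{(k)}(x) = q^k f^{(k)}(θ x)` (derivatives within
`(0,1)`, resp. `J`; Pila–Wilkie 2006, proof of Lemma 3.2/3.3: linear reparametrizations with
coefficients in `[-1, 1]` do not increase the derivative bounds). [folklore] -/
theorem iteratedDerivWithin_comp_affine {J : Set ℝ} (hJ : IsOpen J) (p q : ℝ)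
    (hmaps : MapsTo (fun x => p + q * x) (Ioo (0 : ℝ) 1) J) :
    ∀ (k : ℕ) (f : ℝ → ℝ), ContDiffOn ℝ k f J → ∀ x ∈ Ioo (0 : ℝ) 1,
      iteratedDerivWithin k (fun x => f (p + q * x)) (Ioo 0 1) x =
        q ^ k * iteratedDerivWithin k f J (p + q * x) := by
  intro k
  induction k with
  | zero => intro f _ x _; simp
  | succ k ih =>
    intro f hf x hx
    have hs : UniqueDiffOn ℝ (Ioo (0 : ℝ) 1) := uniqueDiffOn_Ioo 0 1
    have hJu : UniqueDiffOn ℝ J := hJ.uniqueDiffOn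
    -- chain rule: `(f ∘ θ)' = q · (f' ∘ θ)` on `(0,1)`
    have hchain : EqOn (derivWithin (fun x => f (p + q * x)) (Ioo 0 1))
        (fun x => q * derivWithin f J (p + q * x)) (Ioo 0 1) := by
      intro y hy
      have hfd : HasDerivWithinAt f (derivWithin f J (p + q * y)) J ((fun x => p + q * x) y) :=
        ((hf.differentiableOn (by exact_mod_cast Nat.succ_ne_zero k)) _ (hmaps hy)).hasDerivWithinAt
      have hθ : HasDerivWithinAt (fun x : ℝ => p + q * x) q (Ioo 0 1) y := by
        simpa using ((hasDerivAt_id y).const_mul q).const_add p |>.hasDerivWithinAt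
      have h := HasDerivWithinAt.comp y hfd hθ hmaps (h := fun x : ℝ => p + q * x)
      rw [show (fun x => f (p + q * x)) = f ∘ (fun x : ℝ => p + q * x) from rfl,
        h.derivWithin (hs y hy)]
      ring
    have hf' : ContDiffOn ℝ k (derivWithin f J) J := hf.derivWithin hJu (by push_cast; exact le_rfl)
    rw [iteratedDerivWithin_succ', iteratedDerivWithin_congr hchain hx,
      iteratedDerivWithin_const_mul hx hs q ?_, ih (derivWithin f J) hf' x hx,
      iteratedDerivWithin_succ', pow_succ]
    · ring
    · -- smoothness of `f' ∘ θ` within `(0,1)` at `x`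
      have hcomp : ContDiffOn ℝ k (fun x => derivWithin f J (p + q * x)) (Ioo 0 1) :=
        hf'.comp ((contDiff_const.add (contDiff_const.mul contDiff_id)).contDiffOn) hmaps
      exact hcomp x hx

/-- Hence **affine reparametrizations with `|q| ≤ 1` do not increase derivative bounds**:
`|(f ∘ θ)^{(k)}(x)| ≤ |f^{(k)}(θ x)|`. [folklore] -/
theorem abs_iteratedDerivWithin_comp_affine_le {J : Set ℝ} (hJ : IsOpen J) {p q : ℝ}
    (hq : |q| ≤ 1) (hmaps : MapsTo (fun x => p + q * x) (Ioo (0 : ℝ) 1) J) {k : ℕ} {f : ℝ → ℝ}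
    (hf : ContDiffOn ℝ k f J) {x : ℝ} (hx : x ∈ Ioo (0 : ℝ) 1) :
    |iteratedDerivWithin k (fun x => f (p + q * x)) (Ioo 0 1) x| ≤
      |iteratedDerivWithin k f J (p + q * x)| := by
  rw [iteratedDerivWithin_comp_affine hJ p q hmaps k f hf x hx, abs_mul, abs_pow]
  exact mul_le_of_le_one_left (abs_nonneg _) (pow_le_one₀ (abs_nonneg q) hq)

/-- The increasing affine bijection `(0,1) → (a,b)`, `x ↦ a + (b − a) x`. [folklore] -/
theorem mapsTo_affine_Ioo {a b : ℝ} (hab : a < b) :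
    MapsTo (fun x => a + (b - a) * x) (Ioo (0 : ℝ) 1) (Ioo a b) := fun x hx =>
  ⟨by nlinarith [hx.1], by nlinarith [hx.2]⟩

/-- The decreasing affine bijection `(0,1) → (a,b)`, `x ↦ b + (a − b) x`. [folklore] -/
theorem mapsTo_affine_Ioo' {a b : ℝ} (hab : a < b) :
    MapsTo (fun x => b + (a - b) * x) (Ioo (0 : ℝ) 1) (Ioo a b) := fun x hx =>
  ⟨by nlinarith [hx.2], by nlinarith [hx.1]⟩

/-- The image of `(0,1)` under `x ↦ a + (b − a) x` is all of `(a, b)`. [folklore] -/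
theorem image_affine_Ioo {a b : ℝ} (hab : a < b) :
    (fun x => a + (b - a) * x) '' Ioo (0 : ℝ) 1 = Ioo a b := by
  refine Subset.antisymm (mapsTo_affine_Ioo hab).image_subset fun y hy => ?_
  have hba : b - a ≠ 0 := by linarith
  refine ⟨(y - a) / (b - a), ⟨div_pos (by linarith [hy.1]) (by linarith),
    (div_lt_one (by linarith)).mpr (by linarith [hy.2])⟩, ?_⟩
  field_simp
  ring

/-- The image of `(0,1)` under `x ↦ b + (a − b) x` is all of `(a, b)`. [folklore] -/
theorem image_affine_Ioo' {a b : ℝ} (hab : a < b) :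
    (fun x => b + (a - b) * x) '' Ioo (0 : ℝ) 1 = Ioo a b := by
  refine Subset.antisymm (mapsTo_affine_Ioo' hab).image_subset fun y hy => ?_
  have hba : b - a ≠ 0 := by linarith
  refine ⟨(b - y) / (b - a), ⟨div_pos (by linarith [hy.2]) (by linarith),
    (div_lt_one (by linarith)).mpr (by linarith [hy.1])⟩, ?_⟩
  have : a - b = -(b - a) := by ring
  rw [this]
  field_simp
  ring

end Affine





end Literature.ModelTheory.ExponentialFields

end
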